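import Literature.NumberTheory.Automorphic.SolvableGroupStructure
import Literature.NumberTheory.Automorphic.RootSubgroupStructure
import Literature.NumberTheory.Automorphic.FlagFiltrationLayers
import Literature.NumberTheory.Automorphic.SchurZassenhausDivisible
import Literature.NumberTheory.Automorphic.AlgebraicHomImages
import Literature.NumberTheory.Automorphic.TorusTorsion
import Literature.NumberTheory.Automorphic.UnipotentBinomial
import Literature.NumberTheory.Automorphic.IdentityComponent
import Literature.NumberTheory.Automorphic.ZariskiGLGeneration
import HarnessLib

/-!
# Maximal tori of connected solvable groups: existence and conjugacy (Springer 6.3.5, 6.3.6, 6.4.1)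
(trunk T-AUTOMORPHIC, G25 AutomorphicL)

Companion to `SolvableGroupStructure.lean` and `RootSubgroupStructure.lean` (namespace
`Literature.Automorphic`; concrete `k`-points vocabulary: `G ≤ GL n k` Zariski-connected solvable over an
algebraically closed field, tori `IsTorusSubgroup`, maximal tori `IsMaximalTorusIn` = tori of `G`
maximal for inclusion). Main result, proved:

* **`isMaximalTorusIn_conj_of_isSolvable_holds`** — discharge of the named fact
  `isMaximalTorusIn_conj_of_isSolvable` of `RootSubgroupStructure.lean` (**Springer 6.4.1,
  solvable case = 6.3.5 (iii) with 6.3.6 (i)**: *two maximal tori of a connected solvable linear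
  algebraic group are conjugate*), one of the inputs of the uniqueness of root subgroups
  (`rootSubgroup_unique`, Springer 8.1.1 (i));
* frame-free corollaries: `exists_isMaximalTorusIn_of_isSolvable` (6.3.5 (i), (iv): a maximal
  torus `T` exists and `G = T · G_u`), `IsMaximalTorusIn.exists_mul_unipotent` (6.3.5 (iv) for a
  given maximal torus), `exists_mem_centralizer_mul_unipotent` (6.3.6: `G = Z_G(S) · G_u` for a
  subtorus `S`), and `isZConnected_unipotentPart_of_isSolvable` (**6.3.3 (ii): `G_u` is
  connected**, via `SolvableFrame.isZConnected_U`: `T · (G_u)°` has finite index in `G`).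

Springer's proof of 6.3.5 is an induction on `dim G_u` through the quotients `G / N` by a normal
`N ≅ 𝔾ₐ` (6.3.4), using Lie algebras (5.4.5, 5.4.7) and homogeneous spaces (5.5). None of this
is available for the `k`-points vocabulary; the proof formalised here replaces it by a
**finite-group argument**, new as far as we know in this form, whose ingredients are all in the
tree:

1. *The frame* (`SolvableFrame`): by Lie–Kolchin (`LieKolchin.lean`) `G` stabilises a complete
   flag `F`; its diagonal characters `χᵢ` (`SolvableGroupStructure.lean`) assemble into an
   algebraic homomorphism `ψ = diag (χᵢ) : G → 𝔻_N` (`AlgebraicHomImages.diagonalHom`) with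
   kernel the unipotent part `U = G_u = G ∩ Φ₁` and image a torus `S = ψ(G) ≤ 𝔻_N`
   (closed by Springer 2.2.5 (ii), `isAlgebraicSubgroup_range`); `U` is filtered by the
   `Φ_{i+1} ∩ G` (`flagFiltration`, `UnipotentSolvable.lean`) with abelian layers which are
   uniquely `M`-divisible for every `M` invertible in `k` (`FlagFiltrationLayers.lean`; in
   characteristic `0` the `M`-th roots come from `UnipotentBinomial.lean`), i.e. an
   `IsDivisibleFiltration` (`isDivisibleFiltration_layer`).
2. *Finite subgroups with dense union*: for a prime `ℓ ≠ char k` the `ℓ`-power torsion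
   `S[ℓ^j]` is finite, of `ℓ`-power order, and Zariski dense in `S` (`TorusTorsion.lean`).
3. *Lifting and conjugacy of finite subgroups*: by the filtered Schur–Zassenhaus theorem
   (`SchurZassenhausDivisible.lean`) applied to `E_j = ψ⁻¹ (S[ℓ^j]) ⊇ U`, the finite group
   `S[ℓ^j]` lifts to a complement `Q_j ≤ E_j` of `U`, unique up to `U`-conjugacy.
4. *Fixed points* (`SolvableFrame.exists_mem_centralizer_psi_eq`, Springer 6.3.5 (iv)/6.3.6 in the form
   "`G = Z_G(T) · G_u` for every torus `T ≤ G`"): the two complements `T[ℓ^j]` and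
   `g⁻¹ T[ℓ^j] g` of `U` in `T[ℓ^j] U` are `U`-conjugate, so the coset `g U` meets
   `Z_G(T[ℓ^j])`; these closed sets decrease with `j`, so (Noetherian) `g U` meets their
   intersection `Z_G(T)` (density).
5. *Existence of tori of full rank* (`SolvableFrame.exists_torus_range_le_img`, Springer 6.3.5
   (i)/(iv)): the lifts
   `Q_j` can be chosen increasing; their union is an abelian group of semisimple elements, whose
   closure `D` is (conjugate into `𝔻ₙ`, `exists_conj_le_diagonalSubgroup`) an abelian algebraic
   group of semisimple elements with `ψ(D) ⊇ ⋃ S[ℓ^j]`, hence `ψ(D) = S`; its identity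
   component is a torus `T̃ ≤ G` with `ψ(T̃) = S`.
6. *Maximal tori have full rank* (`SolvableFrame.isFull_of_isMaximalTorusIn`, Springer 6.3.6 (i)):
   for `T`
   maximal, `C = Z_G(T)°` satisfies `ψ(C) = S` by 4., contains `T` centrally, and contains a
   torus `T̃` with `ψ(T̃) = S` by 5.; `T T̃` is a torus, so `T̃ ⊆ T` and `ψ(T) = S`.
7. *Conjugacy* (`SolvableFrame.exists_conj_eq_of_isFull`, Springer 6.3.5 (iii)): for tori `T, T'`
   of full
   rank, `T ∩ E_j` and `T' ∩ E_j` are complements of `U` in `E_j`, conjugate by 3.; the closed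
   sets `{x ∈ G | x (T' ∩ E_j) x⁻¹ ⊆ T}` decrease and are non-empty, so some `x ∈ G`
   conjugates all `T'[ℓ^j]` into `T`, hence (density) `T'` into `T`, hence onto `T`
   (`ψ` is injective on tori).

## References

* [SpringerLAG1998] T. A. Springer, *Linear Algebraic Groups*, 2nd ed., Progress in
  Mathematics 9, Birkhäuser (1998): 2.2.1, 6.3.1, 6.3.3, 6.3.5, 6.3.6, 6.4.1.
-/

open scoped MatrixGroups

namespace Literature.NumberTheory.Automorphic

open scoped Matrix

variable {k : Type*} [Field k] {n : Type*} [Fintype n] [DecidableEq n]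

attribute [local instance] zariskiTopologyGL

/-! ### Preliminaries -/

section Prelim

/-- In any field there is a prime `ℓ` which is non-zero in `k` (`2` or `3`). (The same lemma is
proved in `Literature/AlgebraicGeometry/Motives/FaltingsECCardProofs.lean`, not imported here to
keep the import closure small.) [folklore] -/
theorem exists_prime_natCast_ne_zero (k : Type*) [Field k] : ∃ ℓ : ℕ, ℓ.Prime ∧ (ℓ : k) ≠ 0 := by
  by_cases h2 : ((2 : ℕ) : k) = 0
  · refine ⟨3, Nat.prime_three, fun h3 => ?_⟩
    have e : ((3 : ℕ) : k) = ((2 : ℕ) : k) + 1 := by norm_num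
    rw [e, h2, zero_add] at h3
    exact one_ne_zero h3
  · exact ⟨2, Nat.prime_two, h2⟩

/-- **An element of finite order invertible in `k` is semisimple**: its minimal polynomial
divides the separable `X ^ m - 1` (Springer 2.4.2 / 4.? : elements of order prime to the
characteristic are semisimple). [folklore] -/
theorem isSemisimpleElt_of_pow_eq_one {g : GL n k} {m : ℕ} (hm : (m : k) ≠ 0) (h : g ^ m = 1) :
    IsSemisimpleElt g := by
  unfold IsSemisimpleElt
  refine Module.End.isSemisimple_of_squarefree_aeval_eq_zero
    (Polynomial.separable_X_pow_sub_C (1 : k) hm one_ne_zero).squarefree ?_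
  rw [map_sub, map_pow, Polynomial.aeval_X, Polynomial.aeval_C, Module.algebraMap_end_eq_smul_id,
    one_smul, ← Matrix.toLin'_pow, ← Units.val_pow_eq_pow_val, h, Units.val_one, Matrix.toLin'_one,
    LinearMap.id, sub_self]

/-- The `ψ`-fibres `{x ∈ G | f x = c}` of a continuous map on an algebraic `G` are closed in
`GL n k`. [folklore] -/
theorem isClosed_image_fibre {G : Subgroup (GL n k)} (hG : IsAlgebraicSubgroup G)
    {m : Type*} [Fintype m] [DecidableEq m] {f : ↥G → GL m k} (hf : Continuous f) (c : GL m k) :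
    IsClosed ((Subtype.val : ↥G → GL n k) '' (f ⁻¹' {c})) :=
  hG.isClosed.isClosedEmbedding_subtypeVal.isClosedMap _
    ((isClosed_singleton_zariski c).preimage hf)

/-- In a Noetherian space a decreasing sequence of non-empty closed sets has non-empty
intersection (it is eventually constant). [folklore] -/
theorem nonempty_iInter_of_antitone_of_isClosed {X : Type*} [TopologicalSpace X]
    [TopologicalSpace.NoetherianSpace X] {K : ℕ → Set X} (hK : Antitone K)
    (hcl : ∀ j, IsClosed (K j)) (hne : ∀ j, (K j).Nonempty) : (⋂ j, K j).Nonempty := by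
  let C : ℕ → TopologicalSpace.Closeds X := fun j => ⟨K j, hcl j⟩
  obtain ⟨_, ⟨j₀, rfl⟩, hmin⟩ :=
    WellFounded.has_min (wellFounded_lt (α := TopologicalSpace.Closeds X)) (Set.range C)
      ⟨C 0, 0, rfl⟩
  obtain ⟨x, hx⟩ := hne j₀
  refine ⟨x, Set.mem_iInter.2 fun j => ?_⟩
  rcases le_total j j₀ with hj | hj
  · exact hK hj hx
  · -- `K j ⊆ K j₀` and not strictly smaller
    have hle : C j ≤ C j₀ := hK hj
    have hnlt : ¬ C j < C j₀ := hmin (C j) ⟨j, rfl⟩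
    have heq : C j = C j₀ := eq_of_le_of_not_lt hle hnlt
    have hK' : K j = K j₀ := congrArg (fun c : TopologicalSpace.Closeds X => (c : Set X)) heq
    rw [hK']
    exact hx

/-- The binomial one-parameter group through `x ∈ Φ_a` stays in `Φ_a` (characteristic `0`):
`xᵗ - 1` is a polynomial in `x - 1` without constant term. [folklore] -/
theorem unipotentBinomHom_mem_flagFiltration [CharZero k] {F : ℕ → Submodule k (n → k)}
    (hF : Monotone F) {a : ℕ} {x : GL n k} (hx : IsUnipotentElt x)
    (hxa : x ∈ flagFiltration F a) (t : k) :
    unipotentBinomHom hx (Multiplicative.ofAdd t) ∈ flagFiltration F a := by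
  have hxa' := mem_flagFiltration_iff.1 hxa
  set N : Matrix n n k := (x : Matrix n n k) - 1 with hN
  -- `N = x - 1` lowers the flag by `a` and stabilises it; so do its powers and polynomials
  have hNv : ∀ i, ∀ v ∈ F i, N *ᵥ v ∈ F (i - a) := by
    intro i v hv
    have h := (hxa' i).2 v hv
    rwa [glLin_def, Matrix.toLin'_apply, ← Matrix.one_mulVec v, Matrix.mulVec_mulVec,
      Matrix.mul_one, ← Matrix.sub_mulVec] at h
  have hNv' : ∀ i, ∀ v ∈ F i, N *ᵥ v ∈ F i := fun i v hv => hF (Nat.sub_le i a) (hNv i v hv)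
  have hNpow : ∀ (j i : ℕ), ∀ v ∈ F i, (N ^ j) *ᵥ v ∈ F i := by
    intro j
    induction j with
    | zero => intro i v hv; simpa using hv
    | succ j ih =>
      intro i v hv
      rw [pow_succ', ← Matrix.mulVec_mulVec]
      exact hNv' i _ (ih i v hv)
  have hR : ∀ (s : Finset ℕ) (c : ℕ → k) (i : ℕ), ∀ v ∈ F i,
      (∑ j ∈ s, c j • N ^ j) *ᵥ v ∈ F i := by
    intro s c i v hv
    rw [Matrix.sum_mulVec]
    exact Submodule.sum_mem _ fun j _ => by
      rw [Matrix.smul_mulVec]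
      exact Submodule.smul_mem _ _ (hNpow j i v hv)
  rw [mem_flagFiltration_iff]
  intro i
  refine ⟨fun v hv => ?_, fun v hv => ?_⟩
  · rw [glLin_def, Matrix.toLin'_apply, coe_unipotentBinomHom, unipotentBinom]
    exact hR _ _ i v hv
  · have e : glLin (unipotentBinomHom hx (Multiplicative.ofAdd t)) v - v =
        N *ᵥ ((∑ j ∈ Finset.range (Fintype.card n - 1),
          (choosePoly k (j + 1)).eval t • ((x : Matrix n n k) - 1) ^ j) *ᵥ v) := by
      rw [glLin_def, Matrix.toLin'_apply, coe_unipotentBinomHom, Matrix.mulVec_mulVec,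
        ← unipotentBinom_sub_one, Matrix.sub_mulVec, Matrix.one_mulVec]
    rw [e]
    exact hNv i _ (hR _ _ i v hv)


/-! #### Tori containing all `M`-th powers -/

/-- **An algebraic subgroup of a torus containing all `M`-th powers is everything** (`M ≠ 0`):
for a prime `ℓ` prime to `M` and to the characteristic, every `ℓ`-power torsion point `t`
is an `M`-th power (`t = (tᵃ)ᴹ` with `a M + b ℓ^j = 1`), so the subgroup contains the dense
`ℓ`-power torsion (`TorusTorsion.lean`). [folklore] -/
theorem IsTorusSubgroup.le_of_forall_pow_mem [IsAlgClosed k] {T H : Subgroup (GL n k)}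
    (hT : IsTorusSubgroup T) (hH : IsAlgebraicSubgroup H) {M : ℕ} (hM : M ≠ 0)
    (h : ∀ t ∈ T, t ^ M ∈ H) : T ≤ H := by
  -- a prime `ℓ > M`, different from the characteristic
  obtain ⟨p, hp⟩ := CharP.exists k
  obtain ⟨ℓ, hℓge, hℓ⟩ := Nat.exists_infinite_primes (max M p + 1)
  have hℓM : Nat.Coprime (ℓ) M := by
    rw [Nat.Prime.coprime_iff_not_dvd hℓ]
    intro hdvd
    have := Nat.le_of_dvd (Nat.pos_of_ne_zero hM) hdvd
    omega
  have hℓk : (ℓ : k) ≠ 0 := by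
    intro h0
    rw [CharP.cast_eq_zero_iff k p] at h0
    rcases p.eq_zero_or_pos with rfl | hpos
    · rw [zero_dvd_iff] at h0; omega
    · have hpp : p.Prime := (CharP.char_is_prime_or_zero k p).resolve_right hpos.ne'
      have := (Nat.prime_dvd_prime_iff_eq hpp hℓ).1 h0
      omega
  refine hT.le_of_forall_torsion_mem hH hℓ hℓk fun j t ht htj => ?_
  -- Bezout for `ℓ^j` and `M`
  have hcop : Nat.Coprime (ℓ ^ j) M := Nat.Coprime.pow_left j hℓM
  have hbez := Nat.gcd_eq_gcd_ab (ℓ ^ j) M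
  rw [Nat.Coprime.gcd_eq_one hcop, Nat.cast_one] at hbez
  have e : t = (t ^ Nat.gcdB (ℓ ^ j) M) ^ M := by
    rw [← zpow_natCast, ← zpow_mul]
    conv_lhs => rw [← zpow_one t, hbez, zpow_add, zpow_mul, zpow_natCast, htj, one_zpow, one_mul]
    rw [mul_comm]
  rw [e]
  exact h _ (T.zpow_mem ht _)

end Prelim

/-! ### The frame of a connected solvable group: flag, diagonal characters, `ψ`, `U`, layers -/

section Frame

/-- **A frame of a subgroup `G ≤ GL n k`**: a `G`-stable complete flag `F` (Lie–Kolchin) together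
with its diagonal characters `χᵢ : G → 𝔾ₘ`, `i < n` (algebraic; `g v ≡ χᵢ(g) v mod F_i` on
`F_{i+1}`). Every Zariski-connected solvable `G` over an algebraically closed field has one
(`nonempty_solvableFrame`). From it: `ψ = diag (χᵢ) : G → 𝔻ₙ`, the unipotent part
`U = Ker ψ = G_u`, the torus `S = ψ(G)` ("`G / G_u`", Springer 6.3.3 (ii)) and the filtration
of `U` by the `Φ_{i+1} ∩ G`. [folklore] -/
structure SolvableFrame (G : Subgroup (GL n k)) where
  /-- the flag -/
  F : ℕ → Submodule k (n → k)
  /-- it is a `G`-stable complete flag -/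
  flag : IsStableCompleteFlag G F
  /-- the diagonal characters -/
  χ : Fin (Fintype.card n) → (↥G →* kˣ)
  /-- they are algebraic -/
  isAlgebraicChar_χ : ∀ i, IsAlgebraicChar (χ i)
  /-- `χᵢ(g)` is the eigenvalue of `g` on `F_{i+1} / F_i` -/
  χ_spec : ∀ (i : Fin (Fintype.card n)) (g : ↥G), ∀ v ∈ F ((i : ℕ) + 1),
    ((g : GL n k) : Matrix n n k) *ᵥ v - ((χ i g : kˣ) : k) • v ∈ F i

/-- **Every Zariski-connected solvable `G ≤ GL n k` over an algebraically closed field has a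
frame** (Lie–Kolchin `exists_invariant_flag_standardRep`, Springer 6.3.1, and the diagonal
characters `IsStableCompleteFlag.exists_char`). [cite: SpringerLAG1998, 6.3.1] -/
theorem nonempty_solvableFrame [IsAlgClosed k] {G : Subgroup (GL n k)} (hG : IsZConnected G)
    (hsolv : IsSolvable ↥G) : Nonempty (SolvableFrame G) := by
  obtain ⟨F, -, hmono, hstab, hrank⟩ := exists_invariant_flag_standardRep hG hsolv
  have hF : IsStableCompleteFlag G F := ⟨hmono, hstab, hrank⟩
  have hex := fun i : Fin (Fintype.card n) => hF.exists_char i.2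
  choose χ hχalg hχ using hex
  exact ⟨⟨F, hF, χ, hχalg, hχ⟩⟩

namespace SolvableFrame

variable {G : Subgroup (GL n k)} (Φ : SolvableFrame G)

/-- The characters extended by `1` to all indices `i : ℕ` (as used by
`IsStableCompleteFlag.isUnipotentElt_iff`). [folklore] -/
noncomputable def χ' (i : ℕ) : ↥G →* kˣ :=
  if h : i < Fintype.card n then Φ.χ ⟨i, h⟩ else 1

/-- The defining property of the extended characters `χ' i`, `i < n`. [folklore] -/
lemma χ'_spec : ∀ i < Fintype.card n, ∀ (g : ↥G), ∀ v ∈ Φ.F (i + 1),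
    ((g : GL n k) : Matrix n n k) *ᵥ v - ((Φ.χ' i g : kˣ) : k) • v ∈ Φ.F i := by
  intro i hi g v hv
  simp only [χ', dif_pos hi]
  exact Φ.χ_spec ⟨i, hi⟩ g v hv

/-- **`ψ = diag (χ₀, …, χ_{n-1}) : G → 𝔻ₙ`**, the homomorphism "`G → G / G_u`" of a frame
(Springer 6.3.3 (ii)). [folklore] -/
noncomputable def ψ : ↥G →* GL (Fin (Fintype.card n)) k := diagonalHom Φ.χ

/-- `ψ` is algebraic. [folklore] -/
theorem isAlgebraicGL_ψ : MonoidHom.IsAlgebraicGL Φ.ψ :=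
  isAlgebraicGL_diagonalHom Φ.isAlgebraicChar_χ

/-- `ψ` takes values in the diagonal torus. [folklore] -/
theorem ψ_mem_diagonalSubgroup (g : ↥G) : Φ.ψ g ∈ diagonalSubgroup (Fin (Fintype.card n)) k :=
  diagonalHom_mem_diagonalSubgroup _ g

/-- `ψ(G) ≤ 𝔻ₙ`. [folklore] -/
theorem range_ψ_le : Φ.ψ.range ≤ diagonalSubgroup (Fin (Fintype.card n)) k := by
  rintro _ ⟨g, rfl⟩; exact Φ.ψ_mem_diagonalSubgroup g

/-- **`Ker ψ = G_u`**: `ψ g = 1` iff `g` is unipotent (`IsStableCompleteFlag.isUnipotentElt_iff`).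
[cite: SpringerLAG1998, 6.3.3 (ii)] -/
theorem ψ_eq_one_iff (g : ↥G) : Φ.ψ g = 1 ↔ IsUnipotentElt (g : GL n k) := by
  rw [ψ, diagonalHom_eq_one_iff, Φ.flag.isUnipotentElt_iff Φ.χ'_spec]
  constructor
  · intro h i hi
    rw [χ', dif_pos hi]
    exact h ⟨i, hi⟩
  · intro h i
    have := h i i.2
    rwa [χ', dif_pos i.2] at this

/-- `ψ` is commutative-valued: `ψ(G)` is commutative. [folklore] -/
instance isMulCommutative_range_ψ : IsMulCommutative ↥Φ.ψ.range :=
  ⟨⟨fun a b => Subtype.ext (by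
    have h := congrArg Subtype.val
      ((isMulCommutative_diagonalSubgroup (n := Fin (Fintype.card n)) (k := k)).is_comm.comm
        ⟨a.1, Φ.range_ψ_le a.2⟩ ⟨b.1, Φ.range_ψ_le b.2⟩)
    simpa using h)⟩⟩

/-- `ψ` kills commutators (its image is commutative). [folklore] -/
theorem ψ_commutator (g h : ↥G) : Φ.ψ (g * h * g⁻¹ * h⁻¹) = 1 := by
  rw [map_mul, map_mul, map_mul, map_inv, map_inv]
  have hc : Φ.ψ g * Φ.ψ h = Φ.ψ h * Φ.ψ g := by
    have := congrArg Subtype.val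
      (Φ.isMulCommutative_range_ψ.is_comm.comm ⟨Φ.ψ g, g, rfl⟩ ⟨Φ.ψ h, h, rfl⟩)
    simpa using this
  rw [hc, mul_inv_cancel_right, mul_inv_cancel]

/-- **The unipotent part `U = G_u = Ker ψ`** of the frame, as a subgroup of `GL n k`.
[cite: SpringerLAG1998, 6.3.3 (ii)] -/
noncomputable def U : Subgroup (GL n k) := Φ.ψ.ker.map G.subtype

/-- Membership in `U`: the unipotent elements of `G`. [folklore] -/
theorem mem_U_iff {g : GL n k} : g ∈ Φ.U ↔ g ∈ G ∧ IsUnipotentElt g := by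
  constructor
  · rintro ⟨g', hg', rfl⟩
    exact ⟨g'.2, (Φ.ψ_eq_one_iff g').1 hg'⟩
  · rintro ⟨hg, hu⟩
    exact ⟨⟨g, hg⟩, (Φ.ψ_eq_one_iff ⟨g, hg⟩).2 hu, rfl⟩

/-- `U ≤ G`. [folklore] -/
theorem U_le : Φ.U ≤ G := fun _ h => (Φ.mem_U_iff.1 h).1

/-- `U` consists of unipotent elements. [folklore] -/
theorem isUnipotentSubgroup_U : IsUnipotentSubgroup Φ.U := fun _ h => (Φ.mem_U_iff.1 h).2

/-- For `g ∈ G`: `g ∈ U ↔ ψ g = 1`. [folklore] -/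
theorem mem_U_iff_ψ (g : ↥G) : (g : GL n k) ∈ Φ.U ↔ Φ.ψ g = 1 := by
  rw [Φ.mem_U_iff, Φ.ψ_eq_one_iff]
  exact ⟨fun h => h.2, fun h => ⟨g.2, h⟩⟩

/-- Commutators of `G` lie in `U`. [folklore] -/
theorem commutator_mem_U {g h : GL n k} (hg : g ∈ G) (hh : h ∈ G) :
    g * h * g⁻¹ * h⁻¹ ∈ Φ.U := by
  have hmem : g * h * g⁻¹ * h⁻¹ ∈ G :=
    G.mul_mem (G.mul_mem (G.mul_mem hg hh) (G.inv_mem hg)) (G.inv_mem hh)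
  rw [Φ.mem_U_iff]
  refine ⟨hmem, ?_⟩
  have h1 : Φ.ψ ⟨g * h * g⁻¹ * h⁻¹, hmem⟩ = 1 := Φ.ψ_commutator ⟨g, hg⟩ ⟨h, hh⟩
  exact (Φ.ψ_eq_one_iff _).1 h1

/-- `U` is normalised by `G`. [folklore] -/
theorem conj_mem_U {g u : GL n k} (hg : g ∈ G) (hu : u ∈ Φ.U) : g * u * g⁻¹ ∈ Φ.U := by
  have hc := Φ.commutator_mem_U hg (Φ.U_le hu)
  have := Φ.U.mul_mem hc hu
  simpa using this

/-- A torus of `G` meets `U` trivially (semisimple ∩ unipotent = `1`). [folklore] -/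
theorem torus_inf_U {T : Subgroup (GL n k)} (hT : IsTorusSubgroup T) : T ⊓ Φ.U = ⊥ :=
  hT.inf_eq_bot_of_isUnipotentSubgroup Φ.isUnipotentSubgroup_U

/-- `ψ` is injective on a torus `T ≤ G`. [folklore] -/
theorem ψ_injOn_torus {T : Subgroup (GL n k)} (hT : IsTorusSubgroup T) (hTG : T ≤ G)
    {s t : GL n k} (hs : s ∈ T) (ht : t ∈ T) (h : Φ.ψ ⟨s, hTG hs⟩ = Φ.ψ ⟨t, hTG ht⟩) : s = t := by
  have hstT : s * t⁻¹ ∈ T := T.mul_mem hs (T.inv_mem ht)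
  have hst : s * t⁻¹ ∈ T ⊓ Φ.U := by
    refine ⟨hstT, (Φ.mem_U_iff_ψ ⟨s * t⁻¹, hTG hstT⟩).2 ?_⟩
    have e : (⟨s * t⁻¹, hTG hstT⟩ : ↥G) = ⟨s, hTG hs⟩ * ⟨t, hTG ht⟩⁻¹ := rfl
    rw [e, map_mul, map_inv, h, mul_inv_cancel]
  rw [Φ.torus_inf_U hT, Subgroup.mem_bot] at hst
  exact mul_inv_eq_one.1 hst

/-! #### The flag filtration of `G` -/

/-- `G` stabilises its flag: `G ≤ Φ₀`. [folklore] -/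
theorem le_flagFiltration_zero : G ≤ flagFiltration Φ.F 0 := by
  intro g hg
  rw [mem_flagFiltration_iff]
  intro j
  have hst : ∀ v ∈ Φ.F j, glLin g v ∈ Φ.F j := fun v hv => by
    rw [glLin_def, Matrix.toLin'_apply]; exact Φ.flag.stable j g hg v hv
  exact ⟨hst, fun v hv => by rw [Nat.sub_zero]; exact Submodule.sub_mem _ (hst v hv) hv⟩

/-- Beyond the top the flag is constant: `F j = ⊤` for `j ≥ n`. [folklore] -/
theorem F_eq_top {j : ℕ} (hj : Fintype.card n ≤ j) : Φ.F j = ⊤ :=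
  eq_top_iff.2 (Φ.flag.eq_top ▸ Φ.flag.mono hj)

/-- **`U = G ∩ Φ₁`**: an element of `G` is unipotent iff it acts trivially on the graded pieces
of the flag (all diagonal characters are `1`). [cite: SpringerLAG1998, 6.3.3 (ii)] -/
theorem mem_flagFiltration_one_iff (g : ↥G) :
    (g : GL n k) ∈ flagFiltration Φ.F 1 ↔ IsUnipotentElt (g : GL n k) := by
  rw [Φ.flag.isUnipotentElt_iff Φ.χ'_spec, mem_flagFiltration_iff]
  have hst := (mem_flagFiltration_iff.1 (Φ.le_flagFiltration_zero g.2))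
  constructor
  · intro h i hi
    -- `g w - w ∈ F_i` and `g w - χᵢ(g) w ∈ F_i` for `w ∈ F_{i+1}`
    refine Units.ext (Φ.flag.scalar_unique hi (g := (g : GL n k)) (c := ((Φ.χ' i g : kˣ) : k))
      (c' := 1) (Φ.χ'_spec i hi g) fun v hv => ?_) |> fun e => by exact_mod_cast e
    have := (h (i + 1)).2 v hv
    rw [glLin_def, Matrix.toLin'_apply, Nat.add_sub_cancel] at this
    rwa [one_smul]
  · intro h j
    refine ⟨(hst j).1, fun v hv => ?_⟩
    rcases Nat.eq_zero_or_pos j with rfl | hjpos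
    · rw [Φ.flag.eq_bot, Submodule.mem_bot] at hv
      subst hv
      simp
    obtain ⟨i, rfl⟩ := Nat.exists_eq_add_of_le' hjpos
    rw [Nat.add_sub_cancel]
    by_cases hi : i < Fintype.card n
    · have := Φ.χ'_spec i hi g v hv
      rw [h i hi, Units.val_one, one_smul] at this
      rwa [glLin_def, Matrix.toLin'_apply]
    · rw [Φ.F_eq_top (not_lt.1 hi)]
      exact Submodule.mem_top

/-- `U = G ⊓ Φ₁`. [cite: SpringerLAG1998, 6.3.3 (ii)] -/
theorem U_eq_inf : Φ.U = G ⊓ flagFiltration Φ.F 1 := by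
  ext g
  rw [Φ.mem_U_iff, Subgroup.mem_inf]
  constructor
  · rintro ⟨hg, hu⟩
    exact ⟨hg, (Φ.mem_flagFiltration_one_iff ⟨g, hg⟩).2 hu⟩
  · rintro ⟨hg, h1⟩
    exact ⟨hg, (Φ.mem_flagFiltration_one_iff ⟨g, hg⟩).1 h1⟩

/-- **The layers** `Λ_i = G ∩ Φ_{i+1}` of the unipotent part: `Λ₀ = U`, decreasing to `Λₙ = 1`,
normalised by `G`, with abelian quotients `Λ_i / Λ_{i+1}`. [folklore] -/
def layer (i : ℕ) : Subgroup (GL n k) := G ⊓ flagFiltration Φ.F (i + 1)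

/-- `Λ₀ = U`. [folklore] -/
theorem layer_zero : Φ.layer 0 = Φ.U := Φ.U_eq_inf.symm

/-- `Λ_i ≤ G`. [folklore] -/
theorem layer_le (i : ℕ) : Φ.layer i ≤ G := inf_le_left

/-- `Λ_i ≤ U`. [folklore] -/
theorem layer_le_U (i : ℕ) : Φ.layer i ≤ Φ.U := by
  rw [← Φ.layer_zero]
  exact fun g hg => ⟨hg.1, flagFiltration_antitone Φ.flag.mono (by omega) hg.2⟩

/-- The layers decrease. [folklore] -/
theorem layer_succ_le (i : ℕ) : Φ.layer (i + 1) ≤ Φ.layer i :=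
  fun _ hg => ⟨hg.1, flagFiltration_antitone Φ.flag.mono (Nat.le_succ _) hg.2⟩

/-- `Λₙ = 1`. [folklore] -/
theorem layer_card : Φ.layer (Fintype.card n) = ⊥ := by
  rw [layer, flagFiltration_eq_bot Φ.flag.eq_bot Φ.flag.eq_top (Nat.le_succ _), inf_bot_eq]

/-- The layers have abelian quotients: `(Λ_i, Λ_i) ≤ Λ_{i+1}`. [folklore] -/
theorem commutator_layer_le (i : ℕ) : ⁅Φ.layer i, Φ.layer i⁆ ≤ Φ.layer (i + 1) := by
  rw [Subgroup.commutator_le]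
  intro g hg h hh
  refine ⟨?_, ?_⟩
  · exact G.mul_mem (G.mul_mem (G.mul_mem hg.1 hh.1) (G.inv_mem hg.1)) (G.inv_mem hh.1)
  · have := commutator_flagFiltration_le (F := Φ.F) (i + 1) (i + 1)
      (Subgroup.commutator_mem_commutator hg.2 hh.2)
    exact flagFiltration_antitone Φ.flag.mono (by omega) this

/-- The layers are normalised by `G` (`(Φ₀, Φ_{i+1}) ≤ Φ_{i+1}`). [folklore] -/
theorem conj_mem_layer {i : ℕ} {g x : GL n k} (hg : g ∈ G) (hx : x ∈ Φ.layer i) :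
    g * x * g⁻¹ ∈ Φ.layer i := by
  refine ⟨G.mul_mem (G.mul_mem hg hx.1) (G.inv_mem hg), ?_⟩
  have hc : g * x * g⁻¹ * x⁻¹ ∈ flagFiltration Φ.F (i + 1) := by
    have := commutator_flagFiltration_le (F := Φ.F) 0 (i + 1)
      (Subgroup.commutator_mem_commutator (Φ.le_flagFiltration_zero hg) hx.2)
    rwa [Nat.zero_add, commutatorElement_def] at this
  have := (flagFiltration Φ.F (i + 1)).mul_mem hc hx.2
  simpa using this

/-! #### Divisibility of the layers -/

/-- The layers have no `M`-torsion for `M` invertible in `k`. [folklore] -/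
theorem mem_layer_succ_of_pow_mem {i : ℕ} {y : GL n k} (hy : y ∈ Φ.layer i) {M : ℕ}
    (hM : (M : k) ≠ 0) (hyM : y ^ M ∈ Φ.layer (i + 1)) : y ∈ Φ.layer (i + 1) :=
  ⟨hy.1, (pow_mem_flagFiltration_succ_iff Φ.flag.mono (by omega) hy.2 hM).1 hyM.2⟩

/-- In characteristic `p`, `M`-th roots modulo the next layer for `M` prime to `p`: with
`a M + b p = 1`, `y = xᵃ` has `x⁻¹ yᴹ = (xᵖ)^{-b} ∈ Λ_{i+1}`. [folklore] -/
theorem exists_root_layer_of_charP {p : ℕ} [CharP k p] (hp : p.Prime) {i : ℕ} {x : GL n k}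
    (hx : x ∈ Φ.layer i) {M : ℕ} (hM : (M : k) ≠ 0) :
    ∃ y ∈ Φ.layer i, x⁻¹ * y ^ M ∈ Φ.layer (i + 1) := by
  have hcop : Nat.Coprime M p := by
    rw [Nat.coprime_comm, Nat.Prime.coprime_iff_not_dvd hp]
    intro hdvd
    apply hM
    obtain ⟨c, rfl⟩ := hdvd
    rw [Nat.cast_mul, CharP.cast_eq_zero, zero_mul]
  -- Bezout: `M a + p b = 1`
  have hbez := Nat.gcd_eq_gcd_ab M p
  rw [Nat.Coprime.gcd_eq_one hcop, Nat.cast_one] at hbez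
  set a := Nat.gcdA M p
  set b := Nat.gcdB M p
  have hxp : x ^ p ∈ Φ.layer (i + 1) :=
    ⟨G.pow_mem hx.1 p, pow_char_mem_flagFiltration_succ Φ.flag.mono (by omega) hx.2 p⟩
  refine ⟨x ^ a, (Φ.layer i).zpow_mem hx a, ?_⟩
  have e : x⁻¹ * (x ^ a) ^ M = (x ^ p) ^ (-b) := by
    rw [← zpow_natCast, ← zpow_mul, ← zpow_natCast x p, ← zpow_mul, ← zpow_neg_one, ← zpow_add]
    congr 1
    linear_combination -hbez
  rw [e]
  exact (Φ.layer (i + 1)).zpow_mem hxp _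

/-- In characteristic `0`, `M`-th roots in the layers: `y = x^{1/M} ∈ Λ_i` with `yᴹ = x`
(`UnipotentBinomial.lean`). [folklore] -/
theorem exists_root_layer_of_charZero [CharZero k] (hG : IsAlgebraicSubgroup G) {i : ℕ}
    {x : GL n k} (hx : x ∈ Φ.layer i) {M : ℕ} (hM : M ≠ 0) :
    ∃ y ∈ Φ.layer i, x⁻¹ * y ^ M ∈ Φ.layer (i + 1) := by
  have hxu : IsUnipotentElt x := (Φ.mem_U_iff.1 (Φ.layer_le_U i hx)).2
  obtain ⟨t, htG, htM⟩ := exists_pow_eq_of_isUnipotentElt hxu hG hx.1 hM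
  refine ⟨_, ⟨htG, unipotentBinomHom_mem_flagFiltration Φ.flag.mono hxu hx.2 t⟩, ?_⟩
  rw [htM, inv_mul_cancel]
  exact one_mem _

/-- **`M`-th roots in the layers, any characteristic**, for `M` invertible in `k`. [folklore] -/
theorem exists_root_layer (hG : IsAlgebraicSubgroup G) {i : ℕ} {x : GL n k} (hx : x ∈ Φ.layer i)
    {M : ℕ} (hM : (M : k) ≠ 0) : ∃ y ∈ Φ.layer i, x⁻¹ * y ^ M ∈ Φ.layer (i + 1) := by
  obtain ⟨p, hp⟩ := CharP.exists k
  rcases p.eq_zero_or_pos with rfl | hpos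
  · haveI := CharP.charP_to_charZero k
    exact Φ.exists_root_layer_of_charZero hG hx (by rintro rfl; exact hM Nat.cast_zero)
  · haveI : Fact p.Prime := ⟨(CharP.char_is_prime_or_zero k p).resolve_right hpos.ne'⟩
    exact Φ.exists_root_layer_of_charP (Fact.out) hx hM

/-- **The layers of the unipotent part form a divisible filtration** (in the sense of
`SchurZassenhausDivisible.lean`) of `U ∩ E` inside any `U ≤ E ≤ G`, for every `M` invertible
in `k`. [folklore] -/
theorem isDivisibleFiltration_layer (hG : IsAlgebraicSubgroup G) {E : Subgroup (GL n k)}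
    (hUE : Φ.U ≤ E) (hEG : E ≤ G) {M : ℕ} (hM : (M : k) ≠ 0) :
    IsDivisibleFiltration (Φ.U.subgroupOf E) M (fun i => (Φ.layer i).subgroupOf E)
      (Fintype.card n) where
  zero := by simp only [Φ.layer_zero]
  last := by simp only [Φ.layer_card, Subgroup.bot_subgroupOf]
  le_succ i := fun x hx => Φ.layer_succ_le i hx
  normal i := ⟨fun x hx e => by
    simp only [Subgroup.mem_subgroupOf, Subgroup.coe_mul, Subgroup.coe_inv] at hx ⊢
    exact Φ.conj_mem_layer (hEG e.2) hx⟩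
  commutator_le i := by
    rw [Subgroup.commutator_le]
    intro x hx y hy
    simp only [Subgroup.mem_subgroupOf, commutatorElement_def, Subgroup.coe_mul,
      Subgroup.coe_inv] at hx hy ⊢
    exact Φ.commutator_layer_le i (by
      simpa [commutatorElement_def] using Subgroup.commutator_mem_commutator hx hy)
  div i := by
    intro x hx
    rw [Subgroup.mem_subgroupOf] at hx
    obtain ⟨y, hy, hxy⟩ := Φ.exists_root_layer hG hx hM
    refine ⟨⟨y, (Φ.layer_le_U i).trans hUE hy⟩, hy, ?_⟩
    simpa [Subgroup.mem_subgroupOf] using hxy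
  torsionFree i := by
    intro y hy hyM
    rw [Subgroup.mem_subgroupOf] at hy hyM ⊢
    exact Φ.mem_layer_succ_of_pow_mem hy hM (by simpa using hyM)

/-! #### The torus `S = ψ(G)` and the preimages `E_P = ψ⁻¹(P)` -/

/-- **`S = ψ(G)` is a torus** ("`G / G_u` is a torus", Springer 6.3.3 (ii)): closed by
2.2.5 (ii), connected as image of the connected `G`, commutative and semisimple inside `𝔻ₙ`.
[cite: SpringerLAG1998, 6.3.3 (ii)] -/
theorem isTorusSubgroup_range_ψ [IsAlgClosed k] (hG : IsZConnected G) :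
    IsTorusSubgroup Φ.ψ.range :=
  ⟨Φ.isAlgebraicGL_ψ.isZConnected_range hG, Φ.isMulCommutative_range_ψ,
    fun _ hs => isSemisimpleElt_of_mem_diagonalSubgroup (Φ.range_ψ_le hs)⟩

/-- The preimage `E_P = ψ⁻¹(P) ≤ G` of a subgroup `P` of the target of `ψ`, as a subgroup of
`GL n k`. [folklore] -/
noncomputable def pre (P : Subgroup (GL (Fin (Fintype.card n)) k)) : Subgroup (GL n k) :=
  (P.comap Φ.ψ).map G.subtype

variable {P : Subgroup (GL (Fin (Fintype.card n)) k)}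

/-- Membership in `E_P`. [folklore] -/
theorem mem_pre_iff {x : GL n k} : x ∈ Φ.pre P ↔ ∃ hx : x ∈ G, Φ.ψ ⟨x, hx⟩ ∈ P := by
  constructor
  · rintro ⟨x', hx', rfl⟩
    exact ⟨x'.2, hx'⟩
  · rintro ⟨hx, hxP⟩
    exact ⟨⟨x, hx⟩, hxP, rfl⟩

/-- `E_P ≤ G`. [folklore] -/
theorem pre_le : Φ.pre P ≤ G := fun _ h => (Φ.mem_pre_iff.1 h).1

/-- `U ≤ E_P`. [folklore] -/
theorem U_le_pre : Φ.U ≤ Φ.pre P := fun x hx =>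
  Φ.mem_pre_iff.2 ⟨Φ.U_le hx, by rw [(Φ.mem_U_iff_ψ ⟨x, Φ.U_le hx⟩).1 hx]; exact one_mem _⟩

/-- `U ∩ E_P` is normal in `E_P`. [folklore] -/
theorem normal_U_subgroupOf {E : Subgroup (GL n k)} (hEG : E ≤ G) : (Φ.U.subgroupOf E).Normal :=
  ⟨fun u hu e => by
    rw [Subgroup.mem_subgroupOf] at hu ⊢
    simpa only [Subgroup.coe_mul, Subgroup.coe_inv] using Φ.conj_mem_U (hEG e.2) hu⟩

/-- `ψ` restricted to `E_P`. [folklore] -/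
noncomputable def ψPre (P : Subgroup (GL (Fin (Fintype.card n)) k)) :
    ↥(Φ.pre P) →* GL (Fin (Fintype.card n)) k :=
  Φ.ψ.comp (Subgroup.inclusion Φ.pre_le)

/-- Unfolding of `ψPre`. [folklore] -/
lemma ψPre_apply (x : ↥(Φ.pre P)) : Φ.ψPre P x = Φ.ψ ⟨x, Φ.pre_le x.2⟩ := rfl

/-- The kernel of `ψ|E_P` is `U ∩ E_P`. [folklore] -/
theorem ker_ψPre : (Φ.ψPre P).ker = Φ.U.subgroupOf (Φ.pre P) := by
  ext x
  rw [MonoidHom.mem_ker, ψPre_apply, Subgroup.mem_subgroupOf, Φ.mem_U_iff_ψ ⟨x, _⟩]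

/-- The image of `ψ|E_P` is `P` when `P ≤ ψ(G)`. [folklore] -/
theorem range_ψPre (hP : P ≤ Φ.ψ.range) : (Φ.ψPre P).range = P := by
  ext y
  constructor
  · rintro ⟨x, rfl⟩
    rw [ψPre_apply]
    exact (Φ.mem_pre_iff.1 x.2).2
  · intro hy
    obtain ⟨g, rfl⟩ := hP hy
    exact ⟨⟨g, Φ.mem_pre_iff.2 ⟨g.2, hy⟩⟩, rfl⟩

/-- **`[E_P : U] = |P|`** for `P ≤ ψ(G)`. [folklore] -/
theorem index_U_subgroupOf_pre (hP : P ≤ Φ.ψ.range) :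
    (Φ.U.subgroupOf (Φ.pre P)).index = Nat.card ↥P := by
  rw [← Φ.ker_ψPre, Subgroup.index_ker, Φ.range_ψPre hP]

/-- **Lifting finite subgroups of `S` (existence of complements)**: for a finite `P ≤ ψ(G)` of
order invertible in `k`, `U ∩ E_P` has a complement in `E_P = ψ⁻¹(P)` (filtered
Schur–Zassenhaus). [folklore] -/
theorem exists_isComplement_pre (hG : IsAlgebraicSubgroup G) (hP : P ≤ Φ.ψ.range) [Finite ↥P]
    (hcard : ((Nat.card ↥P : ℕ) : k) ≠ 0) :
    ∃ Q : Subgroup ↥(Φ.pre P), Subgroup.IsComplement' (Φ.U.subgroupOf (Φ.pre P)) Q := by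
  haveI := Φ.normal_U_subgroupOf (Φ.pre_le (P := P))
  haveI : (Φ.U.subgroupOf (Φ.pre P)).FiniteIndex :=
    ⟨by rw [Φ.index_U_subgroupOf_pre hP]; exact Nat.card_pos.ne'⟩
  refine exists_isComplement'_of_isDivisibleFiltration (Fintype.card n)
    (Φ.U.subgroupOf (Φ.pre P)) (fun i => (Φ.layer i).subgroupOf (Φ.pre P)) ?_
  rw [Φ.index_U_subgroupOf_pre hP]
  exact Φ.isDivisibleFiltration_layer hG Φ.U_le_pre Φ.pre_le hcard

/-- **Conjugacy of lifts**: two complements of `U ∩ E_P` in `E_P` are conjugate by an element of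
`U ∩ E_P` (filtered Schur–Zassenhaus). [folklore] -/
theorem exists_conj_of_isComplement_pre (hG : IsAlgebraicSubgroup G) (hP : P ≤ Φ.ψ.range)
    [Finite ↥P] (hcard : ((Nat.card ↥P : ℕ) : k) ≠ 0) {Q Q' : Subgroup ↥(Φ.pre P)}
    (hQ : Subgroup.IsComplement' (Φ.U.subgroupOf (Φ.pre P)) Q)
    (hQ' : Subgroup.IsComplement' (Φ.U.subgroupOf (Φ.pre P)) Q') :
    ∃ u ∈ Φ.U.subgroupOf (Φ.pre P), Q' = Q.map (MulAut.conj u).toMonoidHom := by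
  haveI := Φ.normal_U_subgroupOf (Φ.pre_le (P := P))
  haveI : (Φ.U.subgroupOf (Φ.pre P)).FiniteIndex :=
    ⟨by rw [Φ.index_U_subgroupOf_pre hP]; exact Nat.card_pos.ne'⟩
  refine exists_conj_eq_of_isDivisibleFiltration (Fintype.card n)
    (Φ.U.subgroupOf (Φ.pre P)) (fun i => (Φ.layer i).subgroupOf (Φ.pre P)) ?_ hQ hQ'
  rw [Φ.index_U_subgroupOf_pre hP]
  exact Φ.isDivisibleFiltration_layer hG Φ.U_le_pre Φ.pre_le hcard

/-- A complement of `U ∩ E` inside `E ≤ G` is commutative (its commutators lie in `U`).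
[folklore] -/
theorem commutative_of_isComplement {E : Subgroup (GL n k)} (hEG : E ≤ G) {Q : Subgroup ↥E}
    (hQ : Subgroup.IsComplement' (Φ.U.subgroupOf E) Q) (a b : ↥Q) : a * b = b * a := by
  have hc : ((a * b * a⁻¹ * b⁻¹ : ↥Q) : ↥E) ∈ Φ.U.subgroupOf E := by
    rw [Subgroup.mem_subgroupOf]
    simpa only [Subgroup.coe_mul, Subgroup.coe_inv] using
      Φ.commutator_mem_U (hEG (a : ↥E).2) (hEG (b : ↥E).2)
  have hdisj := hQ.disjoint
  rw [disjoint_iff_inf_le] at hdisj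
  have h1 : ((a * b * a⁻¹ * b⁻¹ : ↥Q) : ↥E) = 1 :=
    hdisj (Subgroup.mem_inf.2 ⟨hc, (a * b * a⁻¹ * b⁻¹).2⟩)
  have h2 : a * b * a⁻¹ * b⁻¹ = 1 := Subtype.ext h1
  calc a * b = a * b * a⁻¹ * b⁻¹ * (b * a) := by group
    _ = b * a := by rw [h2, one_mul]

/-- The image `ψ(A)` of a subgroup `A ≤ G`. [folklore] -/
noncomputable def img (A : Subgroup (GL n k)) : Subgroup (GL (Fin (Fintype.card n)) k) :=
  (A.subgroupOf G).map Φ.ψ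

/-- Membership in `ψ(A)`. [folklore] -/
lemma mem_img_iff {A : Subgroup (GL n k)} {y : GL (Fin (Fintype.card n)) k} :
    y ∈ Φ.img A ↔ ∃ (a : GL n k) (ha : a ∈ G), a ∈ A ∧ Φ.ψ ⟨a, ha⟩ = y := by
  constructor
  · rintro ⟨a, ha, rfl⟩
    exact ⟨a, a.2, ha, rfl⟩
  · rintro ⟨a, haG, haA, rfl⟩
    exact ⟨⟨a, haG⟩, haA, rfl⟩

/-- `ψ(A) ≤ ψ(G)`. [folklore] -/
lemma img_le_range (A : Subgroup (GL n k)) : Φ.img A ≤ Φ.ψ.range := Subgroup.map_le_range _ _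

/-! #### Fixed points of tori: `G = Z_G(T) · U` (Springer 6.3.5 (iv), 6.3.6) -/

section FixedPoints

/-- **The coset `g U` meets the centraliser of any finite subgroup `A` of a torus `T ≤ G` of
order invertible in `k`**: the complements `A` and `g⁻¹ A g` of `U` in `ψ⁻¹ ψ(A)` are
`U`-conjugate (`exists_conj_of_isComplement_pre`), and an element of `G` normalising `A` with
commutators in `U` centralises `A`. [folklore] -/
theorem exists_centralizes_finite (hG : IsZConnected G) {T : Subgroup (GL n k)}
    (hT : IsTorusSubgroup T) (hTG : T ≤ G) {A : Subgroup (GL n k)} (hAT : A ≤ T) [Finite ↥A]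
    (hcard : ((Nat.card ↥A : ℕ) : k) ≠ 0) (g : ↥G) :
    ∃ x : ↥G, Φ.ψ x = Φ.ψ g ∧ ∀ a ∈ A, a * x = x * a := by
  classical
  set P := Φ.img A with hPdef
  have hP : P ≤ Φ.ψ.range := Φ.img_le_range A
  have hAG : A ≤ G := hAT.trans hTG
  -- `|P|` divides `|A|`, so it is invertible in `k`
  haveI : Finite ↥(A.subgroupOf G) :=
    Finite.of_equiv _ (Subgroup.subgroupOfEquivOfLe hAG).symm.toEquiv
  haveI : Finite ↥P :=
    Finite.of_surjective (Φ.ψ.subgroupMap (A.subgroupOf G)) (Φ.ψ.subgroupMap_surjective _)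
  have hcardP : ((Nat.card ↥P : ℕ) : k) ≠ 0 := by
    intro h0
    apply hcard
    have hdvd : Nat.card ↥P ∣ Nat.card ↥A := by
      rw [hPdef, img, ← Nat.card_congr (Subgroup.subgroupOfEquivOfLe hAG).toEquiv]
      exact Subgroup.card_map_dvd _ _
    obtain ⟨c, hc⟩ := hdvd
    rw [hc, Nat.cast_mul, h0, zero_mul]
  -- the two complements `A` and `g⁻¹ A g` of `U` in `E_P`
  set E := Φ.pre P with hE
  have hAE : A ≤ E := fun a ha => Φ.mem_pre_iff.2 ⟨hAG ha, ⟨⟨a, hAG ha⟩, ha, rfl⟩⟩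
  have hψconj : ∀ (a : GL n k) (ha : a ∈ G),
      Φ.ψ ⟨(g : GL n k)⁻¹ * a * g, G.mul_mem (G.mul_mem (G.inv_mem g.2) ha) g.2⟩ = Φ.ψ ⟨a, ha⟩ := by
    intro a ha
    have e : (⟨(g : GL n k)⁻¹ * a * g, G.mul_mem (G.mul_mem (G.inv_mem g.2) ha) g.2⟩ : ↥G) =
        g⁻¹ * ⟨a, ha⟩ * g := rfl
    rw [e, map_mul, map_mul, map_inv]
    have hc : Φ.ψ g * Φ.ψ ⟨a, ha⟩ = Φ.ψ ⟨a, ha⟩ * Φ.ψ g := by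
      have := congrArg Subtype.val
        (Φ.isMulCommutative_range_ψ.is_comm.comm ⟨Φ.ψ g, g, rfl⟩ ⟨Φ.ψ ⟨a, ha⟩, ⟨a, ha⟩, rfl⟩)
      simpa using this
    rw [mul_assoc, ← hc, ← mul_assoc, inv_mul_cancel, one_mul]
  set A' : Subgroup (GL n k) := A.map (MulAut.conj (g : GL n k)⁻¹).toMonoidHom with hA'
  have hmemA' : ∀ x, x ∈ A' ↔ (g : GL n k) * x * (g : GL n k)⁻¹ ∈ A := by
    intro x
    rw [hA', Subgroup.mem_map_equiv, MulAut.conj_symm_apply, inv_inv]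
  have hA'G : A' ≤ G := by
    rintro _ ⟨a, ha, rfl⟩
    simp only [MulEquiv.coe_toMonoidHom, MulAut.conj_apply, inv_inv]
    exact G.mul_mem (G.mul_mem (G.inv_mem g.2) (hAG ha)) g.2
  have hA'E : A' ≤ E := by
    rintro _ ⟨a, ha, rfl⟩
    simp only [MulEquiv.coe_toMonoidHom, MulAut.conj_apply, inv_inv]
    refine Φ.mem_pre_iff.2 ⟨G.mul_mem (G.mul_mem (G.inv_mem g.2) (hAG ha)) g.2, ?_⟩
    rw [hψconj a (hAG ha)]
    exact ⟨⟨a, hAG ha⟩, ha, rfl⟩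
  -- both are complements of `U ∩ E` in `E`
  have hcompl : ∀ {B : Subgroup (GL n k)}, B ≤ E → (∀ b ∈ B, IsSemisimpleElt b) →
      (∀ e ∈ E, ∃ b ∈ B, ∃ hb : b ∈ G, ∃ he : e ∈ G, Φ.ψ ⟨e, he⟩ = Φ.ψ ⟨b, hb⟩) →
      Subgroup.IsComplement' (Φ.U.subgroupOf E) (B.subgroupOf E) := by
    intro B hBE hBss hBψ
    refine Subgroup.isComplement'_of_disjoint_and_mul_eq_univ ?_ ?_
    · rw [disjoint_iff_inf_le]
      intro x hx
      obtain ⟨hxU, hxB⟩ := Subgroup.mem_inf.1 hx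
      rw [Subgroup.mem_subgroupOf] at hxU hxB
      have h1 : (x : GL n k) = 1 :=
        (hBss _ hxB).eq_one_of_isUnipotentElt (Φ.mem_U_iff.1 hxU).2
      rw [Subgroup.mem_bot]
      exact Subtype.ext h1
    · refine Set.eq_univ_of_forall fun e => ?_
      obtain ⟨b, hbB, hbG, heG, hψ⟩ := hBψ e e.2
      have hu : (e : GL n k) * b⁻¹ ∈ Φ.U := by
        rw [Φ.mem_U_iff]
        refine ⟨G.mul_mem heG (G.inv_mem hbG), ?_⟩
        rw [← Φ.ψ_eq_one_iff ⟨(e : GL n k) * b⁻¹, G.mul_mem heG (G.inv_mem hbG)⟩]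
        have ee : (⟨(e : GL n k) * b⁻¹, G.mul_mem heG (G.inv_mem hbG)⟩ : ↥G) =
            ⟨e, heG⟩ * ⟨b, hbG⟩⁻¹ := rfl
        rw [ee, map_mul, map_inv, hψ, mul_inv_cancel]
      refine Set.mem_mul.2 ⟨⟨(e : GL n k) * b⁻¹, E.mul_mem e.2 (E.inv_mem (hBE hbB))⟩, ?_,
        ⟨b, hBE hbB⟩, ?_, Subtype.ext ?_⟩
      · rw [SetLike.mem_coe, Subgroup.mem_subgroupOf]; exact hu
      · rw [SetLike.mem_coe, Subgroup.mem_subgroupOf]; exact hbB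
      · change (e : GL n k) * b⁻¹ * b = e
        rw [inv_mul_cancel_right]
  have hQ₁ : Subgroup.IsComplement' (Φ.U.subgroupOf E) (A.subgroupOf E) := by
    refine hcompl hAE (fun a ha => hT.2.2 a (hAT ha)) fun e he => ?_
    obtain ⟨heG, ⟨a, haA, hae⟩⟩ := Φ.mem_pre_iff.1 he
    exact ⟨a, haA, a.2, heG, hae.symm⟩
  have hQ₂ : Subgroup.IsComplement' (Φ.U.subgroupOf E) (A'.subgroupOf E) := by
    refine hcompl hA'E (fun b hb => ?_) fun e he => ?_
    · have := (hT.2.2 _ (hAT ((hmemA' b).1 hb))).conj (g : GL n k)⁻¹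
      simpa [mul_assoc] using this
    · obtain ⟨heG, ⟨a, haA, hae⟩⟩ := Φ.mem_pre_iff.1 he
      have haA' : (a : GL n k) ∈ A := Subgroup.mem_subgroupOf.1 haA
      refine ⟨(g : GL n k)⁻¹ * a * g, (hmemA' _).2 ?_,
        G.mul_mem (G.mul_mem (G.inv_mem g.2) a.2) g.2, heG, ?_⟩
      · have e : (g : GL n k) * ((g : GL n k)⁻¹ * a * g) * (g : GL n k)⁻¹ = a := by group
        rw [e]; exact haA'
      · rw [hψconj a a.2, hae]
  -- so they are conjugate by some `u ∈ U`
  obtain ⟨u, huU, hconj⟩ := Φ.exists_conj_of_isComplement_pre hG.1 hP hcardP hQ₁ hQ₂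
  rw [Subgroup.mem_subgroupOf] at huU
  -- `x = g u` centralises `A`
  refine ⟨⟨(g : GL n k) * u, G.mul_mem g.2 (Φ.U_le huU)⟩, ?_, fun a ha => ?_⟩
  · have e : (⟨(g : GL n k) * u, G.mul_mem g.2 (Φ.U_le huU)⟩ : ↥G) = g * ⟨u, Φ.U_le huU⟩ := rfl
    rw [e, map_mul, (Φ.mem_U_iff_ψ ⟨u, Φ.U_le huU⟩).1 huU, mul_one]
  · -- `u a u⁻¹ ∈ g⁻¹ A g`, i.e. `x a x⁻¹ ∈ A`; and `x a x⁻¹ a⁻¹ ∈ U`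
    have h1 : (⟨(u : GL n k) * a * (u : GL n k)⁻¹, E.mul_mem (E.mul_mem u.2 (hAE ha))
        (E.inv_mem u.2)⟩ : ↥E) ∈ A'.subgroupOf E := by
      rw [hconj]
      exact ⟨⟨a, hAE ha⟩, (Subgroup.mem_subgroupOf).2 ha, rfl⟩
    rw [Subgroup.mem_subgroupOf, hmemA'] at h1
    change (g : GL n k) * ((u : GL n k) * a * (u : GL n k)⁻¹) * (g : GL n k)⁻¹ ∈ A at h1
    set x : GL n k := (g : GL n k) * u with hx
    have hxG : x ∈ G := G.mul_mem g.2 (Φ.U_le huU)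
    have h2 : x * a * x⁻¹ ∈ A := by
      have e : x * a * x⁻¹ = (g : GL n k) * ((u : GL n k) * a * (u : GL n k)⁻¹) * (g : GL n k)⁻¹ := by
        rw [hx]; group
      rw [e]; exact h1
    have h3 : x * a * x⁻¹ * a⁻¹ ∈ A ⊓ Φ.U :=
      ⟨A.mul_mem h2 (A.inv_mem ha), Φ.commutator_mem_U hxG (hAG ha)⟩
    have h4 : A ⊓ Φ.U = ⊥ := by
      rw [eq_bot_iff]
      exact (inf_le_inf_right Φ.U hAT).trans (Φ.torus_inf_U hT).le
    rw [h4, Subgroup.mem_bot] at h3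
    have h5 : x * a = a * x := by
      calc x * a = x * a * x⁻¹ * a⁻¹ * (a * x) := by group
        _ = a * x := by rw [h3, one_mul]
    exact h5.symm

variable [IsAlgClosed k]

/-- **Fixed points of tori** (Springer 6.3.5 (iv) / 6.3.6: `G = Z_G(T) · G_u`): for a torus
`T ≤ G` of the Zariski-connected solvable `G`, every coset `g U` of the unipotent part meets
the centraliser of `T` — there is `x ∈ G` with `ψ x = ψ g` commuting with `T`. Proof: for the
finite `ℓ`-groups `T[ℓ^j]` this is `exists_centralizes_finite`; the sets
`{x ∈ G | ψ x = ψ g, x ∈ Z(T[ℓ^j])}` are closed, non-empty and decreasing, so their intersection is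
non-empty (Noetherian), and an element commuting with all `T[ℓ^j]` commutes with `T` (density,
`TorusTorsion.lean`). [cite: SpringerLAG1998, 6.3.5 (iv)] -/
theorem exists_mem_centralizer_psi_eq (hG : IsZConnected G) {T : Subgroup (GL n k)}
    (hT : IsTorusSubgroup T) (hTG : T ≤ G) (g : ↥G) :
    ∃ x : ↥G, Φ.ψ x = Φ.ψ g ∧ (x : GL n k) ∈ Subgroup.centralizer (T : Set (GL n k)) := by
  classical
  obtain ⟨ℓ, hℓ, hℓk⟩ := exists_prime_natCast_ne_zero k
  haveI : IsMulCommutative ↥T := hT.2.1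
  haveI := noetherianSpace_zariskiGL (n := n) (k := k)
  -- the closed sets `K j`
  let K : ℕ → Set (GL n k) := fun j =>
    (Subtype.val : ↥G → GL n k) '' (Φ.ψ ⁻¹' {Φ.ψ g}) ∩
      (Subgroup.centralizer ((torsionBy T (ℓ ^ j) : Subgroup (GL n k)) : Set (GL n k)) :
        Subgroup (GL n k))
  have hmemK : ∀ j x, x ∈ K j ↔ ∃ hx : x ∈ G, Φ.ψ ⟨x, hx⟩ = Φ.ψ g ∧
      ∀ t ∈ torsionBy T (ℓ ^ j), t * x = x * t := by
    intro j x
    simp only [K, Set.mem_inter_iff, Set.mem_image, Set.mem_preimage, Set.mem_singleton_iff,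
      SetLike.mem_coe, Subgroup.mem_centralizer_iff]
    constructor
    · rintro ⟨⟨x', hx', rfl⟩, hc⟩
      exact ⟨x'.2, hx', hc⟩
    · rintro ⟨hx, hψ, hc⟩
      exact ⟨⟨⟨x, hx⟩, hψ, rfl⟩, hc⟩
  have hKcl : ∀ j, IsClosed (K j) := fun j =>
    (isClosed_image_fibre hG.1 Φ.isAlgebraicGL_ψ.continuous _).inter
      (isAlgebraicSubgroup_centralizer_set _).isClosed
  have hKanti : Antitone K := by
    intro i j hij x hx
    rw [hmemK] at hx ⊢
    obtain ⟨hxG, hψ, hc⟩ := hx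
    exact ⟨hxG, hψ, fun t ht => hc t (torsionBy_mono (pow_dvd_pow ℓ hij) ht)⟩
  have hKne : ∀ j, (K j).Nonempty := by
    intro j
    haveI := finite_torsionBy (T := T) hT.2.2 (M := ℓ ^ j) (pow_ne_zero j hℓ.ne_zero)
    obtain ⟨a, ha⟩ := exists_card_torsionBy_pow_eq (T := T) hT.2.2 hℓ j
    have hcard : ((Nat.card ↥(torsionBy T (ℓ ^ j)) : ℕ) : k) ≠ 0 := by
      rw [ha, Nat.cast_pow]; exact pow_ne_zero _ hℓk
    obtain ⟨x, hxψ, hxc⟩ := Φ.exists_centralizes_finite hG hT hTG torsionBy_le hcard g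
    exact ⟨x, (hmemK j x).2 ⟨x.2, hxψ, hxc⟩⟩
  obtain ⟨x, hx⟩ := nonempty_iInter_of_antitone_of_isClosed hKanti hKcl hKne
  rw [Set.mem_iInter] at hx
  obtain ⟨hxG, hψ, -⟩ := (hmemK 0 x).1 (hx 0)
  refine ⟨⟨x, hxG⟩, hψ, ?_⟩
  rw [Subgroup.mem_centralizer_iff]
  intro t ht
  have hle : T ≤ Subgroup.centralizer {x} :=
    hT.le_centralizer_of_forall_torsion hℓ hℓk fun j t ht htj =>
      ((hmemK j x).1 (hx j)).2.2 t ⟨ht, htj⟩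
  exact Subgroup.mem_centralizer_singleton_iff.1 (hle ht)

end FixedPoints

/-! #### Lifts of finite subgroups of `S`, at the level of subgroups of `GL n k` -/

section Lifts

/-- `Q` is a *lift* over `E` (`U ≤ E ≤ G`): a complement of the unipotent part inside `E`,
i.e. `Q ≤ E`, `Q ∩ U = 1` and `E = U Q`. [folklore] -/
def IsLift (E Q : Subgroup (GL n k)) : Prop :=
  Q ≤ E ∧ Q ⊓ Φ.U = ⊥ ∧ ∀ e ∈ E, ∃ u ∈ Φ.U, ∃ q ∈ Q, u * q = e

variable {E Q : Subgroup (GL n k)}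

variable {Φ} in
/-- A lift is a complement of `U ∩ E` in `E`. [folklore] -/
theorem IsLift.isComplement' (h : Φ.IsLift E Q) :
    Subgroup.IsComplement' (Φ.U.subgroupOf E) (Q.subgroupOf E) := by
  refine Subgroup.isComplement'_of_disjoint_and_mul_eq_univ ?_ ?_
  · rw [disjoint_iff_inf_le]
    intro x hx
    obtain ⟨hxU, hxQ⟩ := Subgroup.mem_inf.1 hx
    rw [Subgroup.mem_subgroupOf] at hxU hxQ
    have : (x : GL n k) ∈ Q ⊓ Φ.U := ⟨hxQ, hxU⟩
    rw [h.2.1, Subgroup.mem_bot] at this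
    rw [Subgroup.mem_bot]
    exact Subtype.ext this
  · refine Set.eq_univ_of_forall fun e => ?_
    obtain ⟨u, hu, q, hq, huq⟩ := h.2.2 e e.2
    have hqE : q ∈ E := h.1 hq
    have huE : u ∈ E := by
      have : u = (e : GL n k) * q⁻¹ := by rw [← huq, mul_inv_cancel_right]
      rw [this]; exact E.mul_mem e.2 (E.inv_mem hqE)
    refine Set.mem_mul.2 ⟨⟨u, huE⟩, ?_, ⟨q, hqE⟩, ?_, Subtype.ext huq⟩
    · rw [SetLike.mem_coe, Subgroup.mem_subgroupOf]; exact hu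
    · rw [SetLike.mem_coe, Subgroup.mem_subgroupOf]; exact hq

/-- Conversely a complement of `U ∩ E` in `E` gives a lift. [folklore] -/
theorem isLift_of_isComplement' {Q' : Subgroup ↥E}
    (h : Subgroup.IsComplement' (Φ.U.subgroupOf E) Q') : Φ.IsLift E (Q'.map E.subtype) := by
  refine ⟨Subgroup.map_subtype_le _, ?_, fun e he => ?_⟩
  · rw [eq_bot_iff]
    rintro x ⟨⟨x', hx', rfl⟩, hxU⟩
    have hdisj := h.disjoint
    rw [disjoint_iff_inf_le] at hdisj
    have : x' ∈ Φ.U.subgroupOf E ⊓ Q' := Subgroup.mem_inf.2 ⟨hxU, hx'⟩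
    have h1 : x' = 1 := hdisj this
    rw [Subgroup.mem_bot, h1, map_one]
  · obtain ⟨⟨u, q⟩, huq⟩ := h.2 ⟨e, he⟩
    refine ⟨u, u.2, q, ⟨q, q.2, rfl⟩, ?_⟩
    exact congrArg Subtype.val huq

/-- **Lifts exist** over `E_P = ψ⁻¹(P)` for `P ≤ ψ(G)` finite of order invertible in `k`.
[folklore] -/
theorem exists_isLift (hG : IsAlgebraicSubgroup G) (hP : P ≤ Φ.ψ.range) [Finite ↥P]
    (hcard : ((Nat.card ↥P : ℕ) : k) ≠ 0) : ∃ Q, Φ.IsLift (Φ.pre P) Q := by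
  obtain ⟨Q', hQ'⟩ := Φ.exists_isComplement_pre hG hP hcard
  exact ⟨_, Φ.isLift_of_isComplement' hQ'⟩

variable {Φ} in
/-- **Lifts are conjugate under `U`** over `E_P = ψ⁻¹(P)`. [folklore] -/
theorem IsLift.exists_conj (hG : IsAlgebraicSubgroup G) (hP : P ≤ Φ.ψ.range) [Finite ↥P]
    (hcard : ((Nat.card ↥P : ℕ) : k) ≠ 0) {Q Q' : Subgroup (GL n k)}
    (hQ : Φ.IsLift (Φ.pre P) Q) (hQ' : Φ.IsLift (Φ.pre P) Q') :
    ∃ u ∈ Φ.U, Q' = Q.map (MulAut.conj u).toMonoidHom := by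
  obtain ⟨u, hu, hconj⟩ :=
    Φ.exists_conj_of_isComplement_pre hG hP hcard hQ.isComplement' hQ'.isComplement'
  rw [Subgroup.mem_subgroupOf] at hu
  refine ⟨u, hu, ?_⟩
  calc Q' = (Q'.subgroupOf (Φ.pre P)).map (Φ.pre P).subtype :=
        (Subgroup.map_subgroupOf_eq_of_le hQ'.1).symm
    _ = ((Q.subgroupOf (Φ.pre P)).map (MulAut.conj u).toMonoidHom).map (Φ.pre P).subtype := by
        rw [hconj]
    _ = Q.map (MulAut.conj (u : GL n k)).toMonoidHom := by
        ext y
        simp only [Subgroup.mem_map, Subgroup.mem_subgroupOf, MulEquiv.coe_toMonoidHom,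
          MulAut.conj_apply, Subgroup.coe_subtype]
        constructor
        · rintro ⟨_, ⟨z, hz, rfl⟩, rfl⟩
          exact ⟨z, hz, by simp⟩
        · rintro ⟨z, hz, rfl⟩
          exact ⟨⟨(u : GL n k) * z * (u : GL n k)⁻¹, (Φ.pre P).mul_mem ((Φ.pre P).mul_mem u.2
            (hQ.1 hz)) ((Φ.pre P).inv_mem u.2)⟩, ⟨⟨z, hQ.1 hz⟩, hz, Subtype.ext (by simp)⟩, rfl⟩

variable {Φ} in
/-- Conjugating a lift by an element of `E ≤ G` gives a lift. [folklore] -/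
theorem IsLift.map_conj (hEG : E ≤ G) (h : Φ.IsLift E Q) {x : GL n k} (hx : x ∈ E) :
    Φ.IsLift E (Q.map (MulAut.conj x).toMonoidHom) := by
  refine ⟨?_, ?_, fun e he => ?_⟩
  · rintro _ ⟨q, hq, rfl⟩
    exact E.mul_mem (E.mul_mem hx (h.1 hq)) (E.inv_mem hx)
  · rw [eq_bot_iff]
    rintro y ⟨⟨q, hq, rfl⟩, hyU⟩
    simp only [MulEquiv.coe_toMonoidHom, MulAut.conj_apply] at hyU ⊢
    have hq' : q ∈ Q ⊓ Φ.U := by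
      refine ⟨hq, ?_⟩
      have := Φ.conj_mem_U (G.inv_mem (hEG hx)) hyU
      simpa [mul_assoc] using this
    rw [h.2.1, Subgroup.mem_bot] at hq'
    rw [Subgroup.mem_bot, hq', mul_one, mul_inv_cancel]
  · obtain ⟨u, hu, q, hq, huq⟩ := h.2.2 (x⁻¹ * e * x) (E.mul_mem (E.mul_mem (E.inv_mem hx) he) hx)
    refine ⟨x * u * x⁻¹, Φ.conj_mem_U (hEG hx) hu, x * q * x⁻¹, ⟨q, hq, rfl⟩, ?_⟩
    calc x * u * x⁻¹ * (x * q * x⁻¹) = x * (u * q) * x⁻¹ := by group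
      _ = e := by rw [huq]; group

variable {Φ} in
/-- Restricting a lift over `E'` to a smaller `E ⊇ U`. [folklore] -/
theorem IsLift.inf {E' : Subgroup (GL n k)} (h : Φ.IsLift E' Q) (hUE : Φ.U ≤ E) (hEE' : E ≤ E') :
    Φ.IsLift E (Q ⊓ E) := by
  refine ⟨inf_le_right, ?_, fun e he => ?_⟩
  · rw [eq_bot_iff]
    rintro y ⟨⟨hyQ, -⟩, hyU⟩
    have : y ∈ Q ⊓ Φ.U := ⟨hyQ, hyU⟩
    rwa [h.2.1] at this
  · obtain ⟨u, hu, q, hq, huq⟩ := h.2.2 e (hEE' he)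
    refine ⟨u, hu, q, ⟨hq, ?_⟩, huq⟩
    have : q = u⁻¹ * e := by rw [← huq, inv_mul_cancel_left]
    rw [this]
    exact E.mul_mem (E.inv_mem (hUE hu)) he

variable {Φ} in
/-- A lift is commutative. [folklore] -/
theorem IsLift.comm (hEG : E ≤ G) (h : Φ.IsLift E Q) {a b : GL n k} (ha : a ∈ Q) (hb : b ∈ Q) :
    a * b = b * a := by
  have := Φ.commutative_of_isComplement hEG h.isComplement' ⟨⟨a, h.1 ha⟩, (Subgroup.mem_subgroupOf).2 ha⟩
    ⟨⟨b, h.1 hb⟩, (Subgroup.mem_subgroupOf).2 hb⟩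
  exact congrArg (fun z : ↥(Q.subgroupOf E) => ((z : ↥E) : GL n k)) this

variable {Φ} in
/-- The image under `ψ` of a lift over `E_P` is `P` (for `P ≤ ψ(G)`): every `y ∈ P` is
`ψ q` for some `q` in the lift. [folklore] -/
theorem IsLift.exists_ψ_eq (hP : P ≤ Φ.ψ.range) (h : Φ.IsLift (Φ.pre P) Q) {y} (hy : y ∈ P) :
    ∃ q, ∃ hq : q ∈ Q, Φ.ψ ⟨q, Φ.pre_le (h.1 hq)⟩ = y := by
  obtain ⟨g, rfl⟩ := hP hy
  obtain ⟨u, hu, q, hq, huq⟩ := h.2.2 g (Φ.mem_pre_iff.2 ⟨g.2, hy⟩)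
  refine ⟨q, hq, ?_⟩
  have e : (⟨q, Φ.pre_le (h.1 hq)⟩ : ↥G) = ⟨u, Φ.U_le hu⟩⁻¹ * g := by
    apply Subtype.ext
    change q = u⁻¹ * g
    rw [← huq, inv_mul_cancel_left]
  rw [e, map_mul, map_inv, (Φ.mem_U_iff_ψ ⟨u, Φ.U_le hu⟩).1 hu, inv_one, one_mul]

end Lifts

/-! #### Existence of tori of full rank (Springer 6.3.5 (i), (iv)) -/

section Existence

variable [IsAlgClosed k]

/-- **Existence of a torus of full rank** (Springer 6.3.5 (i)/(iv): a connected solvable group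
contains a torus `T̃` with `G = T̃ · G_u`): there is a torus `T̃ ≤ G` with `ψ(T̃) = ψ(G)`.
Proof: steps 3 and 5 of the module docstring (increasing lifts `Q_j` of the `S[ℓ^j]`, the
closure `D` of their union, its identity component). [cite: SpringerLAG1998, 6.3.5 (i)] -/
theorem exists_torus_range_le_img (hG : IsZConnected G) :
    ∃ T : Subgroup (GL n k), IsTorusSubgroup T ∧ T ≤ G ∧ Φ.ψ.range ≤ Φ.img T := by
  classical
  obtain ⟨ℓ, hℓ, hℓk⟩ := exists_prime_natCast_ne_zero k
  have hS : IsTorusSubgroup Φ.ψ.range := Φ.isTorusSubgroup_range_ψ hG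
  -- the finite subgroups `P j = S[ℓ^j]` and their preimages `E j`
  let P : ℕ → Subgroup (GL (Fin (Fintype.card n)) k) := fun j => torsionBy Φ.ψ.range (ℓ ^ j)
  have hPle : ∀ j, P j ≤ Φ.ψ.range := fun j => torsionBy_le
  have hPmono : Monotone P := fun i j hij => torsionBy_mono (pow_dvd_pow ℓ hij)
  haveI hPfin : ∀ j, Finite ↥(P j) := fun j =>
    finite_torsionBy hS.2.2 (pow_ne_zero j hℓ.ne_zero)
  have hPcard : ∀ j, ((Nat.card ↥(P j) : ℕ) : k) ≠ 0 := by
    intro j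
    obtain ⟨a, ha⟩ := exists_card_torsionBy_pow_eq (T := Φ.ψ.range) hS.2.2 hℓ j
    change ((Nat.card ↥(torsionBy Φ.ψ.range (ℓ ^ j)) : ℕ) : k) ≠ 0
    rw [ha, Nat.cast_pow]
    exact pow_ne_zero _ hℓk
  let E : ℕ → Subgroup (GL n k) := fun j => Φ.pre (P j)
  have hEmono : Monotone E := fun i j hij x hx => by
    obtain ⟨hxG, hxP⟩ := Φ.mem_pre_iff.1 hx
    exact Φ.mem_pre_iff.2 ⟨hxG, hPmono hij hxP⟩
  -- step: extend a lift over `E j` to a lift over `E (j+1)` containing it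
  have hstep : ∀ j Q, Φ.IsLift (E j) Q → ∃ Q', Φ.IsLift (E (j + 1)) Q' ∧ Q ≤ Q' := by
    intro j Q hQ
    obtain ⟨Q₁, hQ₁⟩ := Φ.exists_isLift hG.1 (hPle (j + 1)) (hPcard (j + 1))
    have hQ₁j : Φ.IsLift (E j) (Q₁ ⊓ E j) := hQ₁.inf Φ.U_le_pre (hEmono (Nat.le_succ j))
    obtain ⟨u, hu, hconj⟩ := IsLift.exists_conj (Φ := Φ) hG.1 (hPle j) (hPcard j) hQ hQ₁j
    -- `Q' = u⁻¹ Q₁ u`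
    have huE : u⁻¹ ∈ E (j + 1) := (E (j + 1)).inv_mem (hEmono (Nat.le_succ j) (Φ.U_le_pre hu))
    refine ⟨Q₁.map (MulAut.conj u⁻¹).toMonoidHom, hQ₁.map_conj Φ.pre_le huE, fun q hq => ?_⟩
    have h1 : u * q * u⁻¹ ∈ Q₁ ⊓ E j := by
      rw [hconj]
      exact ⟨q, hq, rfl⟩
    refine ⟨u * q * u⁻¹, h1.1, ?_⟩
    simp only [MulEquiv.coe_toMonoidHom, MulAut.conj_apply, inv_inv]
    group
  -- the chain of lifts
  obtain ⟨Q₀, hQ₀⟩ := Φ.exists_isLift hG.1 (hPle 0) (hPcard 0)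
  let chain : ℕ → Subgroup (GL n k) := fun j =>
    Nat.rec Q₀ (fun i Q => if h : Φ.IsLift (E i) Q then (hstep i Q h).choose else ⊥) j
  have hchain0 : chain 0 = Q₀ := rfl
  have hchainS : ∀ j, chain (j + 1) =
      (if h : Φ.IsLift (E j) (chain j) then (hstep j (chain j) h).choose else ⊥) := fun j => rfl
  have hlift : ∀ j, Φ.IsLift (E j) (chain j) ∧ chain j ≤ chain (j + 1) := by
    intro j
    induction j with
    | zero =>
      refine ⟨hchain0 ▸ hQ₀, ?_⟩
      rw [hchainS, dif_pos (hchain0 ▸ hQ₀)]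
      exact (hstep 0 _ (hchain0 ▸ hQ₀)).choose_spec.2
    | succ j ih =>
      have hj1 : Φ.IsLift (E (j + 1)) (chain (j + 1)) := by
        rw [hchainS, dif_pos ih.1]
        exact (hstep j _ ih.1).choose_spec.1
      refine ⟨hj1, ?_⟩
      rw [hchainS (j + 1), dif_pos hj1]
      exact (hstep (j + 1) _ hj1).choose_spec.2
  have hmono : Monotone chain := monotone_nat_of_le_succ fun j => (hlift j).2
  -- the union `Q∞`
  set Qinf : Subgroup (GL n k) := ⨆ j, chain j with hQinf
  have hmemQ : ∀ x, x ∈ Qinf ↔ ∃ j, x ∈ chain j := fun x =>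
    Subgroup.mem_iSup_of_directed hmono.directed_le
  have hQG : Qinf ≤ G := by
    intro x hx
    obtain ⟨j, hj⟩ := (hmemQ x).1 hx
    exact Φ.pre_le ((hlift j).1.1 hj)
  have hQcomm : IsMulCommutative ↥Qinf := by
    refine ⟨⟨fun a b => Subtype.ext ?_⟩⟩
    obtain ⟨i, hi⟩ := (hmemQ a).1 a.2
    obtain ⟨j, hj⟩ := (hmemQ b).1 b.2
    exact (hlift (max i j)).1.comm Φ.pre_le (hmono (le_max_left i j) hi)
      (hmono (le_max_right i j) hj)
  have hQss : ∀ x ∈ Qinf, IsSemisimpleElt x := by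
    intro x hx
    obtain ⟨j, hj⟩ := (hmemQ x).1 hx
    have hxE : x ∈ E j := (hlift j).1.1 hj
    obtain ⟨hxG, hxP⟩ := Φ.mem_pre_iff.1 hxE
    -- `x ^ ℓ^j ∈ U ∩ chain j = 1`
    have hpow : x ^ ℓ ^ j ∈ chain j ⊓ Φ.U := by
      refine ⟨(chain j).pow_mem hj _, (Φ.mem_U_iff_ψ ⟨x ^ ℓ ^ j, G.pow_mem hxG _⟩).2 ?_⟩
      have e : (⟨x ^ ℓ ^ j, G.pow_mem hxG _⟩ : ↥G) = ⟨x, hxG⟩ ^ ℓ ^ j := rfl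
      rw [e, map_pow]
      exact hxP.2
    rw [(hlift j).1.2.1, Subgroup.mem_bot] at hpow
    exact isSemisimpleElt_of_pow_eq_one (by rw [Nat.cast_pow]; exact pow_ne_zero _ hℓk) hpow
  -- conjugate `Q∞` into the diagonal torus; its closure `D`
  obtain ⟨x, hx⟩ := exists_conj_le_diagonalSubgroup hQcomm hQss
  set D : Subgroup (GL n k) := zariskiClosure Qinf with hD
  have hDalg : IsAlgebraicSubgroup D := isAlgebraicSubgroup_zariskiClosure _
  have hDG : D ≤ G := zariskiClosure_le hG.1 hQG
  have hDconj : D.map (MulAut.conj x).toMonoidHom ≤ diagonalSubgroup n k :=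
    (map_conj_zariskiClosure_le Qinf x).trans
      (zariskiClosure_le isAlgebraicSubgroup_diagonalSubgroup hx)
  have hDss : ∀ d ∈ D, IsSemisimpleElt d := by
    intro d hd
    have h1 : x * d * x⁻¹ ∈ diagonalSubgroup n k := hDconj ⟨d, hd, rfl⟩
    have := (isSemisimpleElt_of_mem_diagonalSubgroup h1).conj x⁻¹
    simpa [mul_assoc] using this
  have hDcomm : ∀ a ∈ D, ∀ b ∈ D, a * b = b * a := by
    intro a ha b hb
    have ha' : x * a * x⁻¹ ∈ diagonalSubgroup n k := hDconj ⟨a, ha, rfl⟩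
    have hb' : x * b * x⁻¹ ∈ diagonalSubgroup n k := hDconj ⟨b, hb, rfl⟩
    have hc := congrArg Subtype.val
      ((isMulCommutative_diagonalSubgroup (n := n) (k := k)).is_comm.comm ⟨_, ha'⟩ ⟨_, hb'⟩)
    simp only [Subgroup.coe_mul] at hc
    have : x * (a * b) * x⁻¹ = x * (b * a) * x⁻¹ := by
      calc x * (a * b) * x⁻¹ = (x * a * x⁻¹) * (x * b * x⁻¹) := by group
        _ = (x * b * x⁻¹) * (x * a * x⁻¹) := hc
        _ = x * (b * a) * x⁻¹ := by group
    simpa using this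
  -- the torus `T̃ = D°`
  set T := identityComponent D with hT
  have hTD : T ≤ D := identityComponent_le D
  have hTtorus : IsTorusSubgroup T :=
    ⟨isZConnected_identityComponent hDalg,
      ⟨⟨fun a b => Subtype.ext (hDcomm _ (hTD a.2) _ (hTD b.2))⟩⟩,
      fun t ht => hDss t (hTD ht)⟩
  refine ⟨T, hTtorus, hTD.trans hDG, ?_⟩
  -- `ψ(D) = S` by density
  have himgD : Φ.ψ.range ≤ Φ.img D := by
    refine hS.le_of_forall_torsion_mem
      (Φ.isAlgebraicGL_ψ.isAlgebraicSubgroup_map_of_le hDalg hDG) hℓ hℓk fun j y hy hyj => ?_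
    have hyP : y ∈ P j := ⟨hy, hyj⟩
    obtain ⟨q, hq, hqy⟩ := (hlift j).1.exists_ψ_eq (hPle j) hyP
    have hqD : q ∈ D := le_zariskiClosure _ ((hmemQ q).2 ⟨j, hq⟩)
    exact Φ.mem_img_iff.2 ⟨q, _, hqD, hqy⟩
  -- `ψ(T̃) ⊇ ψ(D)^M = S` for `M = [D : T̃]`
  haveI : ((identityComponent D).subgroupOf D).Normal := normal_identityComponent
  haveI hfi : ((identityComponent D).subgroupOf D).FiniteIndex := finiteIndex_identityComponent hDalg
  set M := ((identityComponent D).subgroupOf D).index with hM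
  have himgT : IsAlgebraicSubgroup (Φ.img T) :=
    Φ.isAlgebraicGL_ψ.isAlgebraicSubgroup_map_of_le (isAlgebraicSubgroup_identityComponent hDalg)
      (hTD.trans hDG)
  refine hS.le_of_forall_pow_mem himgT hfi.index_ne_zero fun s hs => ?_
  obtain ⟨d, hdG, hdD, rfl⟩ := Φ.mem_img_iff.1 (himgD hs)
  have hdM : d ^ M ∈ T := by
    have := Subgroup.pow_index_mem ((identityComponent D).subgroupOf D) ⟨d, hdD⟩
    rw [Subgroup.mem_subgroupOf] at this
    simpa using this
  rw [← map_pow]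
  exact Φ.mem_img_iff.2 ⟨d ^ M, G.pow_mem hdG M, hdM, rfl⟩

end Existence

/-! #### Maximal tori have full rank (Springer 6.3.6 (i)); conjugacy (6.3.5 (iii)) -/

section Conjugacy

variable [IsAlgClosed k]

/-- **Full rank**: `ψ(T) = ψ(G)`, i.e. every `ψ`-fibre meets `T`. [folklore] -/
def IsFull (T : Subgroup (GL n k)) : Prop :=
  ∀ g : ↥G, ∃ t ∈ T, ∃ htG : t ∈ G, Φ.ψ ⟨t, htG⟩ = Φ.ψ g

omit [IsAlgClosed k] in
/-- `ψ(G) ≤ ψ(T)` means `T` is full. [folklore] -/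
theorem isFull_of_range_le_img {T : Subgroup (GL n k)} (h : Φ.ψ.range ≤ Φ.img T) : Φ.IsFull T := by
  intro g
  obtain ⟨t, htG, htT, hte⟩ := Φ.mem_img_iff.1 (h ⟨g, rfl⟩)
  exact ⟨t, htT, htG, hte⟩

/-- **Maximal tori of a connected solvable group have full rank** (Springer 6.3.6 (i): a subtorus
maximal for inclusion has dimension `dim G/G_u`). Proof: step 6 of the module docstring, with
the frame of the connected solvable group `C = Z_G(T)°`. [cite: SpringerLAG1998, 6.3.6 (i)] -/
theorem isFull_of_isMaximalTorusIn (hG : IsZConnected G) (hsolv : IsSolvable ↥G)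
    {T : Subgroup (GL n k)} (hT : IsMaximalTorusIn T G) : Φ.IsFull T := by
  classical
  obtain ⟨hTG, hTtorus, hTmax⟩ := hT
  haveI : IsMulCommutative ↥T := hTtorus.2.1
  -- `C = (G ∩ Z(T))°`, connected solvable, `T ≤ C` central
  set C₁ : Subgroup (GL n k) := G ⊓ Subgroup.centralizer (T : Set (GL n k)) with hC₁
  have hC₁alg : IsAlgebraicSubgroup C₁ := hG.1.inf (isAlgebraicSubgroup_centralizer_set _)
  set C := identityComponent C₁ with hC
  have hCC₁ : C ≤ C₁ := identityComponent_le C₁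
  have hCG : C ≤ G := hCC₁.trans inf_le_left
  have hCconn : IsZConnected C := isZConnected_identityComponent hC₁alg
  have hCsolv : IsSolvable ↥C :=
    solvable_of_solvable_injective (f := Subgroup.inclusion hCG) (Subgroup.inclusion_injective hCG)
  have hTC₁ : T ≤ C₁ := by
    refine le_inf hTG fun t ht => ?_
    rw [Subgroup.mem_centralizer_iff]
    intro s hs
    exact congrArg Subtype.val (IsMulCommutative.is_comm.comm (⟨s, hs⟩ : ↥T) ⟨t, ht⟩)
  have hTC : T ≤ C := hTtorus.1.le_of_finiteIndex hTC₁ (isAlgebraicSubgroup_identityComponent hC₁alg)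
    (finiteIndex_identityComponent hC₁alg)
  -- a frame of `C` and a torus of full rank in it
  obtain ⟨Ψ⟩ := nonempty_solvableFrame hCconn hCsolv
  obtain ⟨T', hT'torus, hT'C, hT'full⟩ := Ψ.exists_torus_range_le_img hCconn
  -- `T ⊔ T'` is a torus of `G` containing `T`, hence `T' ≤ T`
  have hcommTT' : ∀ t ∈ T, ∀ s ∈ T', t * s = s * t := by
    intro t ht s hs
    have h1 := Subgroup.mem_centralizer_iff.1 (Subgroup.mem_inf.1 (hCC₁ (hT'C hs))).2
    exact h1 t ht
  let TT : Subgroup (GL n k) :=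
    { carrier := {x | ∃ t ∈ T, ∃ s ∈ T', t * s = x}
      one_mem' := ⟨1, T.one_mem, 1, T'.one_mem, mul_one 1⟩
      mul_mem' := by
        rintro _ _ ⟨t, ht, s, hs, rfl⟩ ⟨t', ht', s', hs', rfl⟩
        refine ⟨t * t', T.mul_mem ht ht', s * s', T'.mul_mem hs hs', ?_⟩
        calc t * t' * (s * s') = t * (t' * s) * s' := by group
          _ = t * (s * t') * s' := by rw [hcommTT' t' ht' s hs]
          _ = t * s * (t' * s') := by group
      inv_mem' := by
        rintro _ ⟨t, ht, s, hs, rfl⟩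
        refine ⟨t⁻¹, T.inv_mem ht, s⁻¹, T'.inv_mem hs, ?_⟩
        rw [mul_inv_rev]
        exact (Commute.inv_inv (hcommTT' t ht s hs)).eq }
  have hTTsup : T ⊔ T' = TT := by
    apply le_antisymm
    · exact sup_le (fun t ht => ⟨t, ht, 1, T'.one_mem, mul_one t⟩)
        (fun s hs => ⟨1, T.one_mem, s, hs, one_mul s⟩)
    · rintro _ ⟨t, ht, s, hs, rfl⟩
      exact (T ⊔ T').mul_mem (Subgroup.mem_sup_left ht) (Subgroup.mem_sup_right hs)
  have hTTtorus : IsTorusSubgroup (T ⊔ T') := by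
    refine ⟨isZConnected_sup hTtorus.1 hT'torus.1, ⟨⟨fun a b => Subtype.ext ?_⟩⟩, fun x hx => ?_⟩
    · obtain ⟨t, ht, s, hs, ha⟩ := (hTTsup ▸ a.2 : (a : GL n k) ∈ TT)
      obtain ⟨t', ht', s', hs', hb⟩ := (hTTsup ▸ b.2 : (b : GL n k) ∈ TT)
      change (a : GL n k) * b = b * a
      rw [← ha, ← hb]
      have h1 := congrArg Subtype.val (IsMulCommutative.is_comm.comm (⟨t, ht⟩ : ↥T) ⟨t', ht'⟩)
      have h2 := congrArg Subtype.val (hT'torus.2.1.is_comm.comm (⟨s, hs⟩ : ↥T') ⟨s', hs'⟩)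
      simp only [Subgroup.coe_mul] at h1 h2
      calc t * s * (t' * s') = t * (s * t') * s' := by group
        _ = t * (t' * s) * s' := by rw [hcommTT' t' ht' s hs]
        _ = (t * t') * (s * s') := by group
        _ = (t' * t) * (s' * s) := by rw [h1, h2]
        _ = t' * (t * s') * s := by group
        _ = t' * (s' * t) * s := by rw [hcommTT' t ht s' hs']
        _ = t' * s' * (t * s) := by group
    · obtain ⟨t, ht, s, hs, rfl⟩ := (hTTsup ▸ hx : x ∈ TT)
      unfold IsSemisimpleElt
      rw [Units.val_mul, Matrix.toLin'_mul]
      exact Module.End.IsSemisimple.mul_of_commute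
        (commute_toLin'_iff.2 (congrArg Units.val (hcommTT' t ht s hs)))
        (hTtorus.2.2 t ht) (hT'torus.2.2 s hs)
  have hTT'eq : T ⊔ T' = T :=
    hTmax (T ⊔ T') le_sup_left (sup_le hTG (hT'C.trans hCG)) hTTtorus
  have hT'T : T' ≤ T := hTT'eq ▸ le_sup_right
  -- full rank: `ψ(g)^M ∈ ψ(T)` with `M = [C₁ : C]`, then all of `ψ(G) ≤ ψ(T)`
  haveI : ((identityComponent C₁).subgroupOf C₁).Normal := normal_identityComponent
  haveI hfi : ((identityComponent C₁).subgroupOf C₁).FiniteIndex := finiteIndex_identityComponent hC₁alg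
  set M := ((identityComponent C₁).subgroupOf C₁).index with hM
  have hS : IsTorusSubgroup Φ.ψ.range := Φ.isTorusSubgroup_range_ψ hG
  have himgT : IsAlgebraicSubgroup (Φ.img T) :=
    Φ.isAlgebraicGL_ψ.isAlgebraicSubgroup_map_of_le hTtorus.1.1 hTG
  refine Φ.isFull_of_range_le_img (hS.le_of_forall_pow_mem himgT hfi.index_ne_zero fun s hs => ?_)
  obtain ⟨g, rfl⟩ := hs
  -- `x ∈ C₁` with `ψ x = ψ g`; `x ^ M ∈ C = T' · C_u`
  obtain ⟨x, hxψ, hxc⟩ := Φ.exists_mem_centralizer_psi_eq hG hTtorus hTG g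
  have hxC₁ : (x : GL n k) ∈ C₁ := ⟨x.2, hxc⟩
  have hxMC : (x : GL n k) ^ M ∈ C := by
    have := Subgroup.pow_index_mem ((identityComponent C₁).subgroupOf C₁) ⟨x, hxC₁⟩
    rw [Subgroup.mem_subgroupOf] at this
    simpa using this
  obtain ⟨t, htC, htT', hte⟩ := Ψ.mem_img_iff.1 (hT'full ⟨⟨(x : GL n k) ^ M, hxMC⟩, rfl⟩)
  -- `t⁻¹ x^M ∈ C` is unipotent (kernel of `Ψ.ψ`), hence `ψ t = ψ x^M`
  have hu : IsUnipotentElt (t⁻¹ * (x : GL n k) ^ M) := by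
    have h1 : Ψ.ψ (⟨t, htC⟩⁻¹ * ⟨(x : GL n k) ^ M, hxMC⟩) = 1 := by
      rw [map_mul, map_inv, hte, inv_mul_cancel]
    exact (Ψ.ψ_eq_one_iff _).1 h1
  have htG : t ∈ G := hTG (hT'T htT')
  have hψt : Φ.ψ ⟨t, htG⟩ = Φ.ψ g ^ M := by
    have h2 : Φ.ψ (⟨t, htG⟩⁻¹ * x ^ M) = 1 := (Φ.ψ_eq_one_iff _).2 hu
    rw [map_mul, map_inv, map_pow, hxψ, inv_mul_eq_one] at h2
    exact h2
  rw [← hψt]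
  exact Φ.mem_img_iff.2 ⟨t, htG, hT'T htT', rfl⟩

/-- **Conjugacy of tori of full rank** (Springer 6.3.5 (iii)): two tori `T, T' ≤ G` with
`ψ(T) = ψ(T') = ψ(G)` are conjugate under `G`. Proof: step 7 of the module docstring.
[cite: SpringerLAG1998, 6.3.5 (iii)] -/
theorem exists_conj_eq_of_isFull (hG : IsZConnected G) {T T' : Subgroup (GL n k)}
    (hT : IsTorusSubgroup T) (hTG : T ≤ G) (hTfull : Φ.IsFull T)
    (hT' : IsTorusSubgroup T') (hT'G : T' ≤ G) (hT'full : Φ.IsFull T') :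
    ∃ g ∈ G, T' = T.map (MulAut.conj g).toMonoidHom := by
  classical
  obtain ⟨ℓ, hℓ, hℓk⟩ := exists_prime_natCast_ne_zero k
  haveI := noetherianSpace_zariskiGL (n := n) (k := k)
  haveI : IsMulCommutative ↥T' := hT'.2.1
  have hS : IsTorusSubgroup Φ.ψ.range := Φ.isTorusSubgroup_range_ψ hG
  let P : ℕ → Subgroup (GL (Fin (Fintype.card n)) k) := fun j => torsionBy Φ.ψ.range (ℓ ^ j)
  have hPle : ∀ j, P j ≤ Φ.ψ.range := fun j => torsionBy_le
  have hPmono : Monotone P := fun i j hij => torsionBy_mono (pow_dvd_pow ℓ hij)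
  haveI hPfin : ∀ j, Finite ↥(P j) := fun j =>
    finite_torsionBy hS.2.2 (pow_ne_zero j hℓ.ne_zero)
  have hPcard : ∀ j, ((Nat.card ↥(P j) : ℕ) : k) ≠ 0 := by
    intro j
    obtain ⟨a, ha⟩ := exists_card_torsionBy_pow_eq (T := Φ.ψ.range) hS.2.2 hℓ j
    change ((Nat.card ↥(torsionBy Φ.ψ.range (ℓ ^ j)) : ℕ) : k) ≠ 0
    rw [ha, Nat.cast_pow]
    exact pow_ne_zero _ hℓk
  let E : ℕ → Subgroup (GL n k) := fun j => Φ.pre (P j)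
  have hEmono : Monotone E := fun i j hij x hx => by
    obtain ⟨hxG, hxP⟩ := Φ.mem_pre_iff.1 hx
    exact Φ.mem_pre_iff.2 ⟨hxG, hPmono hij hxP⟩
  -- full tori give lifts `T ∩ E j`
  have hlift : ∀ {A : Subgroup (GL n k)}, IsTorusSubgroup A → A ≤ G → Φ.IsFull A →
      ∀ j, Φ.IsLift (E j) (A ⊓ E j) := by
    intro A hA hAG hAfull j
    refine ⟨inf_le_right, ?_, fun e he => ?_⟩
    · rw [eq_bot_iff]
      rintro y ⟨⟨hyA, -⟩, hyU⟩
      have : y ∈ A ⊓ Φ.U := ⟨hyA, hyU⟩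
      rwa [Φ.torus_inf_U hA] at this
    · obtain ⟨heG, heP⟩ := Φ.mem_pre_iff.1 he
      obtain ⟨t, htA, htG, hte⟩ := hAfull ⟨e, heG⟩
      have htE : t ∈ E j := Φ.mem_pre_iff.2 ⟨htG, by rw [hte]; exact heP⟩
      refine ⟨e * t⁻¹, ?_, t, ⟨htA, htE⟩, by rw [inv_mul_cancel_right]⟩
      rw [Φ.mem_U_iff]
      refine ⟨G.mul_mem heG (G.inv_mem htG), ?_⟩
      rw [← Φ.ψ_eq_one_iff ⟨e * t⁻¹, G.mul_mem heG (G.inv_mem htG)⟩]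
      have ee : (⟨e * t⁻¹, G.mul_mem heG (G.inv_mem htG)⟩ : ↥G) = ⟨e, heG⟩ * ⟨t, htG⟩⁻¹ := rfl
      rw [ee, map_mul, map_inv, hte, mul_inv_cancel]
  -- the closed sets `L j = {x ∈ G | x (T' ∩ E j) x⁻¹ ⊆ T}`
  let L : ℕ → Set (GL n k) := fun j => (G : Set (GL n k)) ∩
    ⋂ t ∈ (T' ⊓ E j : Subgroup (GL n k)), (fun x : GL n k => x * t * x⁻¹) ⁻¹' (T : Set (GL n k))
  have hmemL : ∀ j x, x ∈ L j ↔ x ∈ G ∧ ∀ t ∈ T' ⊓ E j, x * t * x⁻¹ ∈ T := by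
    intro j x
    simp only [L, Set.mem_inter_iff, SetLike.mem_coe, Set.mem_iInter, Set.mem_preimage]
  have hLcl : ∀ j, IsClosed (L j) := fun j =>
    hG.1.isClosed.inter (isClosed_biInter fun t _ =>
      hT.1.1.isClosed.preimage (isPolyMapGL_conj_apply t).continuous)
  have hLanti : Antitone L := by
    intro i j hij x hx
    rw [hmemL] at hx ⊢
    exact ⟨hx.1, fun t ht => hx.2 t ⟨ht.1, hEmono hij ht.2⟩⟩
  have hLne : ∀ j, (L j).Nonempty := by
    intro j
    obtain ⟨u, hu, hconj⟩ := IsLift.exists_conj (Φ := Φ) hG.1 (hPle j) (hPcard j)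
      (hlift hT hTG hTfull j) (hlift hT' hT'G hT'full j)
    refine ⟨u⁻¹, (hmemL j _).2 ⟨G.inv_mem (Φ.U_le hu), fun t ht => ?_⟩⟩
    have : t ∈ (T ⊓ E j).map (MulAut.conj u).toMonoidHom := hconj ▸ ht
    obtain ⟨s, hs, rfl⟩ := this
    simp only [MulEquiv.coe_toMonoidHom, MulAut.conj_apply]
    have e : u⁻¹ * (u * s * u⁻¹) * u⁻¹⁻¹ = s := by group
    rw [e]
    exact hs.1
  obtain ⟨x, hx⟩ := nonempty_iInter_of_antitone_of_isClosed hLanti hLcl hLne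
  rw [Set.mem_iInter] at hx
  have hxG : x ∈ G := ((hmemL 0 x).1 (hx 0)).1
  -- `x T'[ℓ^j] x⁻¹ ⊆ T` for all `j`, hence `x T' x⁻¹ ⊆ T` by density
  have hconjT' : T' ≤ T.map (MulAut.conj x⁻¹).toMonoidHom := by
    refine hT'.le_of_forall_torsion_mem (hT.1.1.map_conj' x⁻¹) hℓ hℓk fun j t ht htj => ?_
    rw [Subgroup.mem_map_equiv, MulAut.conj_symm_apply, inv_inv]
    have htE : t ∈ E j := by
      refine Φ.mem_pre_iff.2 ⟨hT'G ht, ⟨⟨⟨t, hT'G ht⟩, rfl⟩, ?_⟩⟩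
      rw [← map_pow]
      have e : (⟨t, hT'G ht⟩ : ↥G) ^ ℓ ^ j = 1 := Subtype.ext (by simpa using htj)
      rw [e, map_one]
    have := ((hmemL j x).1 (hx j)).2 t ⟨ht, htE⟩
    simpa [mul_assoc] using this
  -- `x T' x⁻¹` is a full torus inside `T`, hence equal to `T`
  have hmemconj : ∀ y, y ∈ T.map (MulAut.conj x⁻¹).toMonoidHom ↔ x * y * x⁻¹ ∈ T := by
    intro y
    rw [Subgroup.mem_map_equiv, MulAut.conj_symm_apply, inv_inv]
  have heq : T.map (MulAut.conj x⁻¹).toMonoidHom = T' := by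
    refine le_antisymm ?_ hconjT'
    intro y hy
    rw [hmemconj] at hy
    -- fullness of `T'` at `x⁻¹ ... `: pick `t' ∈ T'` with `ψ t' = ψ y`
    have hyG : y ∈ G := by
      have := G.mul_mem (G.mul_mem (G.inv_mem hxG) (hTG hy)) hxG
      simpa [mul_assoc] using this
    obtain ⟨t', ht'T', ht'G, ht'e⟩ := hT'full ⟨y, hyG⟩
    -- `t'⁻¹ y` is unipotent and lies in the torus `x⁻¹ T x`, so it is `1`
    have hu : IsUnipotentElt (t'⁻¹ * y) := by
      have h1 : Φ.ψ (⟨t', ht'G⟩⁻¹ * ⟨y, hyG⟩) = 1 := by rw [map_mul, map_inv, ht'e, inv_mul_cancel]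
      exact (Φ.ψ_eq_one_iff _).1 h1
    have hmem : t'⁻¹ * y ∈ T.map (MulAut.conj x⁻¹).toMonoidHom :=
      Subgroup.mul_mem _ (Subgroup.inv_mem _ (hconjT' ht'T')) ((hmemconj y).2 hy)
    have hss : IsSemisimpleElt (t'⁻¹ * y) := (hT.map_conj x⁻¹).2.2 _ hmem
    have h1 : t'⁻¹ * y = 1 := hss.eq_one_of_isUnipotentElt hu
    rw [inv_mul_eq_one] at h1
    rw [← h1]; exact ht'T'
  refine ⟨x⁻¹, G.inv_mem hxG, heq.symm⟩

end Conjugacy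

variable {Φ} in
/-- A full torus contained in a torus of `G` equals it (the quotient would be unipotent and
semisimple). [folklore] -/
theorem IsFull.eq_of_le [IsAlgClosed k] {T T₂ : Subgroup (GL n k)} (hTfull : Φ.IsFull T)
    (hT₂ : IsTorusSubgroup T₂) (hT₂G : T₂ ≤ G) (h : T ≤ T₂) : T = T₂ := by
  refine le_antisymm h fun y hy => ?_
  obtain ⟨t, htT, htG, hte⟩ := hTfull ⟨y, hT₂G hy⟩
  have hu : IsUnipotentElt (t⁻¹ * y) := by
    have h1 : Φ.ψ (⟨t, htG⟩⁻¹ * ⟨y, hT₂G hy⟩) = 1 := by rw [map_mul, map_inv, hte, inv_mul_cancel]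
    exact (Φ.ψ_eq_one_iff _).1 h1
  have hss : IsSemisimpleElt (t⁻¹ * y) := hT₂.2.2 _ (T₂.mul_mem (T₂.inv_mem (h htT)) hy)
  have h1 : t⁻¹ * y = 1 := hss.eq_one_of_isUnipotentElt hu
  rw [inv_mul_eq_one] at h1
  rw [← h1]; exact htT

variable {Φ} in
/-- A full torus is a maximal torus. [folklore] -/
theorem IsFull.isMaximalTorusIn [IsAlgClosed k] {T : Subgroup (GL n k)} (hTfull : Φ.IsFull T)
    (hT : IsTorusSubgroup T) (hTG : T ≤ G) : IsMaximalTorusIn T G :=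
  ⟨hTG, hT, fun _ hTT₂ hT₂G hT₂ => (hTfull.eq_of_le hT₂ hT₂G hTT₂).symm⟩

/-! #### The unipotent part is connected (Springer 6.3.3 (ii)) -/

/-- `U` is algebraic (`G ∩ {unipotent}` is closed). [folklore] -/
theorem isAlgebraicSubgroup_U (hG : IsAlgebraicSubgroup G) : IsAlgebraicSubgroup Φ.U := by
  rw [isAlgebraicSubgroup_iff_isClosed]
  have e : (Φ.U : Set (GL n k)) = (G : Set (GL n k)) ∩ {g | IsUnipotentElt g} := by
    ext g; exact Φ.mem_U_iff
  rw [e]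
  exact hG.isClosed.inter isClosed_setOf_isUnipotentElt

/-- **Springer 6.3.3 (ii): the unipotent part `G_u` of a connected solvable group is connected.**
Proof (in place of Springer's passage to `G / G_u°` and 6.3.2): with a torus `T` of full rank
(`exists_torus_range_le_img`), `T · (G_u)°` is a connected algebraic subgroup of finite index in
`G = T · G_u`, hence all of `G`; so `G_u = (G_u)°`. [cite: SpringerLAG1998, 6.3.3 (ii)] -/
theorem isZConnected_U [IsAlgClosed k] (hG : IsZConnected G) : IsZConnected Φ.U := by
  classical
  have hUalg : IsAlgebraicSubgroup Φ.U := Φ.isAlgebraicSubgroup_U hG.1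
  set U₀ := identityComponent Φ.U with hU₀
  have hU₀U : U₀ ≤ Φ.U := identityComponent_le _
  have hU₀conn : IsZConnected U₀ := isZConnected_identityComponent hUalg
  haveI hfi : (U₀.subgroupOf Φ.U).FiniteIndex := finiteIndex_identityComponent hUalg
  -- `U₀` is normalised by `G`
  have hU₀conj : ∀ g ∈ G, ∀ u ∈ U₀, g * u * g⁻¹ ∈ U₀ := by
    intro g hg u hu
    -- `g U₀ g⁻¹` is a connected algebraic finite-index subgroup of `U`, so it contains `U₀`;
    -- applied to `g⁻¹` this gives `g⁻¹ U₀ g ⊇ U₀`? We argue directly: `g⁻¹ U₀ g ≤ U` is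
    -- connected, hence `≤ U₀` by 2.2.1 (iii).
    set c : GL n k →* GL n k := (MulAut.conj g).toMonoidHom with hc
    have hle : U₀.map c ≤ Φ.U := by
      rintro _ ⟨v, hv, rfl⟩
      exact Φ.conj_mem_U hg (hU₀U hv)
    have hconn : IsZConnected (U₀.map c) := hU₀conn.map_conj g
    have h1 : U₀.map c ≤ U₀ :=
      hconn.le_of_finiteIndex hle (isAlgebraicSubgroup_identityComponent hUalg) hfi
    exact h1 ⟨u, hu, rfl⟩
  -- a torus of full rank and `H = T · U₀`
  obtain ⟨T, hT, hTG, hfull⟩ := Φ.exists_torus_range_le_img hG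
  have hTfull := Φ.isFull_of_range_le_img hfull
  let H : Subgroup (GL n k) :=
    { carrier := {x | ∃ t ∈ T, ∃ u ∈ U₀, t * u = x}
      one_mem' := ⟨1, T.one_mem, 1, U₀.one_mem, mul_one 1⟩
      mul_mem' := by
        rintro _ _ ⟨t, ht, u, hu, rfl⟩ ⟨t', ht', u', hu', rfl⟩
        refine ⟨t * t', T.mul_mem ht ht', (t'⁻¹ * u * t') * u', U₀.mul_mem ?_ hu', by group⟩
        have := hU₀conj t'⁻¹ (G.inv_mem (hTG ht')) u hu
        simpa using this
      inv_mem' := by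
        rintro _ ⟨t, ht, u, hu, rfl⟩
        refine ⟨t⁻¹, T.inv_mem ht, t * u⁻¹ * t⁻¹, hU₀conj t (hTG ht) _ (U₀.inv_mem hu), by group⟩ }
  have hHsup : T ⊔ U₀ = H := by
    apply le_antisymm
    · exact sup_le (fun t ht => ⟨t, ht, 1, U₀.one_mem, mul_one t⟩)
        (fun u hu => ⟨1, T.one_mem, u, hu, one_mul u⟩)
    · rintro _ ⟨t, ht, u, hu, rfl⟩
      exact (T ⊔ U₀).mul_mem (Subgroup.mem_sup_left ht) (Subgroup.mem_sup_right hu)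
  have hHconn : IsZConnected (T ⊔ U₀) := isZConnected_sup hT.1 hU₀conn
  have hHG : T ⊔ U₀ ≤ G := sup_le hTG (hU₀U.trans Φ.U_le)
  -- `T ⊔ U₀` has finite index in `G`: every `x ∈ G` is `c h t⁻¹` with `c` one of the finitely many
  -- coset representatives of `U₀` in `U`, `h ∈ U₀`, `t ∈ T`
  set H' : Subgroup ↥G := (T ⊔ U₀).subgroupOf G with hH'
  haveI : Finite (↥Φ.U ⧸ U₀.subgroupOf Φ.U) := Subgroup.finite_quotient_of_finiteIndex
  have hfiG : H'.FiniteIndex := by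
    let f : (↥Φ.U ⧸ U₀.subgroupOf Φ.U) → (↥G ⧸ H') := fun q =>
      QuotientGroup.mk ⟨((q.out : ↥Φ.U) : GL n k), Φ.U_le (q.out : ↥Φ.U).2⟩
    haveI : Finite (↥G ⧸ H') := by
      refine Finite.of_surjective f fun y => ?_
      induction y using QuotientGroup.induction_on with
      | H x =>
        -- `x⁻¹ = t u`
        obtain ⟨t, htT, htG, hte⟩ := hTfull x⁻¹
        have hu : IsUnipotentElt (t⁻¹ * (x : GL n k)⁻¹) := by
          have h1 : Φ.ψ (⟨t, htG⟩⁻¹ * x⁻¹) = 1 := by rw [map_mul, map_inv, hte, inv_mul_cancel]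
          have h2 := (Φ.ψ_eq_one_iff _).1 h1
          simpa only [Subgroup.coe_mul, Subgroup.coe_inv] using h2
        set u : GL n k := t⁻¹ * (x : GL n k)⁻¹ with hudef
        have huU : u ∈ Φ.U := Φ.mem_U_iff.2 ⟨G.mul_mem (G.inv_mem htG) (G.inv_mem x.2), hu⟩
        have huinvU : u⁻¹ ∈ Φ.U := Φ.U.inv_mem huU
        let q : ↥Φ.U ⧸ U₀.subgroupOf Φ.U := QuotientGroup.mk ⟨u⁻¹, huinvU⟩
        refine ⟨q, ?_⟩
        obtain ⟨h, hq⟩ := QuotientGroup.mk_out_eq_mul (U₀.subgroupOf Φ.U) (⟨u⁻¹, huinvU⟩ : ↥Φ.U)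
        -- `c = u⁻¹ h`, and `x = u⁻¹ t⁻¹ = c (h⁻¹ t⁻¹)` with `h⁻¹ t⁻¹ ∈ H`
        change QuotientGroup.mk _ = QuotientGroup.mk x
        rw [QuotientGroup.eq, hH', Subgroup.mem_subgroupOf]
        have hc : ((q.out : ↥Φ.U) : GL n k) = u⁻¹ * (h : ↥Φ.U) := by
          have := congrArg (fun z : ↥Φ.U => (z : GL n k)) hq
          simpa using this
        have hhU₀ : ((h : ↥Φ.U) : GL n k) ∈ U₀ := by
          have := h.2; rwa [Subgroup.mem_subgroupOf] at this
        have hx : (x : GL n k) = u⁻¹ * t⁻¹ := by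
          rw [hudef, mul_inv_rev, inv_inv, inv_inv, mul_inv_cancel_right]
        simp only [Subgroup.coe_mul, Subgroup.coe_inv, hc, hx]
        rw [hHsup]
        refine ⟨t⁻¹, T.inv_mem htT, t * ((h : ↥Φ.U) : GL n k)⁻¹ * t⁻¹,
          hU₀conj t (hTG htT) _ (U₀.inv_mem hhU₀), ?_⟩
        group
    exact Subgroup.finiteIndex_of_finite_quotient
  -- hence `T ⊔ U₀ = G`
  have hHeq : T ⊔ U₀ = G := hG.2 (T ⊔ U₀) hHG hHconn.1 hfiG
  -- and `U = U₀`: `u = t u₀` forces `t ∈ T ∩ U = 1`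
  have hUU₀ : Φ.U ≤ U₀ := by
    intro u hu
    have : u ∈ H := by rw [← hHsup, hHeq]; exact Φ.U_le hu
    obtain ⟨t, ht, u₀, hu₀, rfl⟩ := this
    have htU : t ∈ T ⊓ Φ.U := ⟨ht, by simpa using Φ.U.mul_mem hu (Φ.U.inv_mem (hU₀U hu₀))⟩
    rw [Φ.torus_inf_U hT, Subgroup.mem_bot] at htU
    rw [htU, one_mul]; exact hu₀
  rw [show Φ.U = U₀ from le_antisymm hUU₀ hU₀U]
  exact hU₀conn

end SolvableFrame

end Frame

/-! ### Springer 6.3.5–6.3.6 and 6.4.1 (solvable case), frame-free statements -/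

section MaximalTori

variable [IsAlgClosed k] {G : Subgroup (GL n k)}

omit [IsAlgClosed k] in
/-- **Springer 6.4.1, solvable case (= 6.3.5 (iii) with 6.3.6 (i)): maximal tori of a connected
solvable group are conjugate** — discharge of the named fact `isMaximalTorusIn_conj_of_isSolvable`
of `RootSubgroupStructure.lean`: for `G ≤ GL n k` Zariski-connected solvable over an
algebraically closed field and `T, T'` maximal tori of `G` (tori of `G` maximal for inclusion),
`T' = g T g⁻¹` for some `g ∈ G`. Proof: maximal tori are full (`isFull_of_isMaximalTorusIn`,
6.3.6 (i)) and full tori are conjugate (`exists_conj_eq_of_isFull`, 6.3.5 (iii)); see the module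
docstring for the finite-group argument replacing Springer's induction over `G / N`.
[cite: SpringerLAG1998, 6.4.1 (solvable case: 6.3.5 (iii), 6.3.6 (i))] -/
theorem isMaximalTorusIn_conj_of_isSolvable_holds :
    isMaximalTorusIn_conj_of_isSolvable (k := k) (n := n) := by
  intro _ G T T' hG hsolv hT hT'
  obtain ⟨Φ⟩ := nonempty_solvableFrame hG hsolv
  exact Φ.exists_conj_eq_of_isFull hG hT.2.1 hT.1 (Φ.isFull_of_isMaximalTorusIn hG hsolv hT)
    hT'.2.1 hT'.1 (Φ.isFull_of_isMaximalTorusIn hG hsolv hT')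

/-- **Springer 6.3.5 (i), (iv): a connected solvable group has a maximal torus `T`, and
`G = T · G_u`**: there is a maximal torus `T` of `G` such that every `g ∈ G` is `t u` with
`t ∈ T` and `u` unipotent. [cite: SpringerLAG1998, 6.3.5 (i), (iv)] -/
theorem exists_isMaximalTorusIn_of_isSolvable (hG : IsZConnected G) (hsolv : IsSolvable ↥G) :
    ∃ T : Subgroup (GL n k), IsMaximalTorusIn T G ∧ ∀ g ∈ G, ∃ t ∈ T, IsUnipotentElt (t⁻¹ * g) := by
  obtain ⟨Φ⟩ := nonempty_solvableFrame hG hsolv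
  obtain ⟨T, hT, hTG, hfull⟩ := Φ.exists_torus_range_le_img hG
  have hTfull := Φ.isFull_of_range_le_img hfull
  refine ⟨T, hTfull.isMaximalTorusIn hT hTG, fun g hg => ?_⟩
  obtain ⟨t, htT, htG, hte⟩ := hTfull ⟨g, hg⟩
  have h1 : Φ.ψ (⟨t, htG⟩⁻¹ * ⟨g, hg⟩) = 1 := by rw [map_mul, map_inv, hte, inv_mul_cancel]
  have h2 := (Φ.ψ_eq_one_iff _).1 h1
  exact ⟨t, htT, by simpa only [Subgroup.coe_mul, Subgroup.coe_inv] using h2⟩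

/-- **Springer 6.3.5 (iv) / 6.3.6 (i) for a given maximal torus: `G = T · G_u`** — every element
of a connected solvable `G` is `t u` with `t` in the maximal torus `T` and `u` unipotent.
[cite: SpringerLAG1998, 6.3.5 (iv)] -/
theorem IsMaximalTorusIn.exists_mul_unipotent (hG : IsZConnected G) (hsolv : IsSolvable ↥G)
    {T : Subgroup (GL n k)} (hT : IsMaximalTorusIn T G) {g : GL n k} (hg : g ∈ G) :
    ∃ t ∈ T, IsUnipotentElt (t⁻¹ * g) := by
  obtain ⟨Φ⟩ := nonempty_solvableFrame hG hsolv
  obtain ⟨t, htT, htG, hte⟩ := Φ.isFull_of_isMaximalTorusIn hG hsolv hT ⟨g, hg⟩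
  have h1 : Φ.ψ (⟨t, htG⟩⁻¹ * ⟨g, hg⟩) = 1 := by rw [map_mul, map_inv, hte, inv_mul_cancel]
  have h2 := (Φ.ψ_eq_one_iff _).1 h1
  exact ⟨t, htT, by simpa only [Subgroup.coe_mul, Subgroup.coe_inv] using h2⟩

/-- **Fixed points of tori, frame-free** (Springer 6.3.5 (iv) / 6.3.6: `G = Z_G(S) · G_u` for a
subtorus `S`): for a torus `S ≤ G` of the connected solvable `G` and `g ∈ G` there is `x ∈ G`
centralising `S` with `x⁻¹ g` unipotent. [cite: SpringerLAG1998, 6.3.6] -/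
theorem exists_mem_centralizer_mul_unipotent (hG : IsZConnected G) (hsolv : IsSolvable ↥G)
    {S : Subgroup (GL n k)} (hS : IsTorusSubgroup S) (hSG : S ≤ G) {g : GL n k} (hg : g ∈ G) :
    ∃ x ∈ G, x ∈ Subgroup.centralizer (S : Set (GL n k)) ∧ IsUnipotentElt (x⁻¹ * g) := by
  obtain ⟨Φ⟩ := nonempty_solvableFrame hG hsolv
  obtain ⟨x, hxψ, hxc⟩ := Φ.exists_mem_centralizer_psi_eq hG hS hSG ⟨g, hg⟩
  have h1 : Φ.ψ (x⁻¹ * ⟨g, hg⟩) = 1 := by rw [map_mul, map_inv, hxψ, inv_mul_cancel]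
  have h2 := (Φ.ψ_eq_one_iff _).1 h1
  exact ⟨x, x.2, hxc, by simpa only [Subgroup.coe_mul, Subgroup.coe_inv] using h2⟩

/-- **Springer 6.3.3 (ii), complete: the unipotent part of a connected solvable group is a
connected algebraic normal subgroup** (complementing `exists_unipotentPart_of_isSolvable` of
`SolvableGroupStructure.lean`, which gives algebraic + normal + `⊇ (G, G)`): the unipotent
elements of a Zariski-connected solvable `G ≤ GL n k` over an algebraically closed field form a
Zariski-connected subgroup. [cite: SpringerLAG1998, 6.3.3 (ii)] -/
theorem isZConnected_unipotentPart_of_isSolvable (hG : IsZConnected G) (hsolv : IsSolvable ↥G) :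
    ∃ U : Subgroup (GL n k), (∀ g, g ∈ U ↔ g ∈ G ∧ IsUnipotentElt g) ∧ IsZConnected U := by
  obtain ⟨Φ⟩ := nonempty_solvableFrame hG hsolv
  exact ⟨Φ.U, fun g => Φ.mem_U_iff, Φ.isZConnected_U hG⟩

end MaximalTori

end Literature.NumberTheory.Automorphic
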